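import Literature.Computability.QuantumComplexity.ZXCalculusSwitchCore
import HarnessLib

/-!
# ZX-calculus: transporting transistor laws to the switch; XOR-ing the target into the control

The switch `sw` is the transistor with its target wire transposed.  We make this precise
(`flat_core_eq_switch`: feeding the transistor's target from a cup and capping its output gives `sw`), so that every law
of the transistor `L = R` yields a law of the switch by bending both sides (`congrArg` with the bending context).  As the
first instance we transport JPV'19's `swapped-CNOT-under-controlsep`:
`(Z^{(1,2)} ⊗ 𝕀) ⨾ (𝕀 ⊗ (√2 ⊗ X^{(2,1)})) ⨾ sw = (𝕀 ⊗ X(π)) ⨾ sw` — copying the target (green) and XOR-ing one copy into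
the control negates the control (`t ∧ ¬(t ⊕ x) = t ∧ x`).
[cite: JeandelPerdrixVilmart2019, §3.1 and Appendix B, Lemma `swapped-CNOT-under-controlsep`; JeandelPerdrixVilmart2018, §2.2, Appendix Lemma 29]
-/

namespace Literature.Computability.QuantumComplexity

open ZXDiagram

namespace ZXClass

/-! Private copies `tc_*` of six lemmas of `ZXCalculusTransistor` (its olean is not served by the farm), the transistor
written out as its core `√2 ⊗ ((X^{(1,2)} ⊗ 𝕀) ⨾ (T ⊗ (Z^{(2,1)} ⨾ Tᵗ)) ⨾ Z^{(2,1)})`. -/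

/-- The red copy with a triangle on one branch, merged: `X^{(1,2)} ⨾ (T ⊗ 𝕀) ⨾ Z^{(2,1)} = 1/√2 ⊗ (X(π) ⨾ T)`
(the looped triangle, transposed). [cite: JeandelPerdrixVilmart2018, Appendix Lemmas 21, 29] -/
private theorem tc_xsplit_seq_triangle_par_seq_merge : mk (X 1 2 0) ⨟ (mk triangle ⊠ mk (wires 1)) ⨟ mk (Z 2 1 0) = mk invSqrtTwo ⊠ (mk (X 1 1 4) ⨟ mk triangle) := by
  have h := congrArg transpose triangleT_seq_X_pi_eq_loop
  rw [transpose_seq, transpose_transpose, transpose_mk (X 1 1 4), ZXDiagram.transpose_X, transpose_par, transpose_mk (dumbbell 0 0), mk_transpose_dumbbell,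
    transpose_seq, transpose_seq, transpose_par, transpose_transpose, transpose_mk (Z 1 2 0), transpose_mk (X 2 1 0), transpose_mk (wires 1),
    ZXDiagram.transpose_Z, ZXDiagram.transpose_X, ZXDiagram.transpose_wires, ← seq_assoc] at h
  rw [← invSqrtTwo_par_sqrt_two_par_one (mk (X 1 2 0) ⨟ (mk triangle ⊠ mk (wires 1)) ⨟ mk (Z 2 1 0)), ← h]

/-- The red copy with three outputs is symmetric in its last two. [cite: JeandelPerdrixVilmart2018, §2.2] -/
private theorem tc_X_one_three_seq_par_swap : mk (X 1 3 0) ⨟ (mk (wires 1) ⊠ mk swap) = mk (X 1 3 0) := by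
  have h := congrArg colorSwap Z_one_three_seq_par_swap
  simpa using h

/-- `X^{(1,2)} ⨾ (X^{(1,2)} ⊗ 𝕀) = X^{(1,3)}`. [cite: JeandelPerdrixVilmart2018, Fig. 1 (S1)] -/
private theorem tc_xsplit_seq_xsplit_par : mk (X 1 2 0) ⨟ (mk (X 1 2 0) ⊠ mk (wires 1)) = mk (X 1 3 0) := by
  have h := congrArg colorSwap (Z_seq_Z_par 1 1 1 2 le_rfl 0 0)
  simpa using h

/-- **The W-merge is symmetric** (the transposes of the fork and of its mirror image agree):
`(𝕀 ⊗ X^{(1,2)}) ⨾ ((Z^{(2,1)} ⨾ Tᵗ) ⊗ 𝕀) ⨾ Z^{(2,1)} = (X^{(1,2)} ⊗ 𝕀) ⨾ (𝕀 ⊗ (Z^{(2,1)} ⨾ Tᵗ)) ⨾ Z^{(2,1)}`.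
[cite: JeandelPerdrixVilmart2018, Appendix Lemma 30 (black dot: swappable outputs), transposed] -/
private theorem tc_wMerge_symm : (mk (wires 1) ⊠ mk (X 1 2 0)) ⨟ ((mk (Z 2 1 0) ⨟ (mk triangle).transpose) ⊠ mk (wires 1)) ⨟ mk (Z 2 1 0) = (mk (X 1 2 0) ⊠ mk (wires 1)) ⨟ (mk (wires 1) ⊠ (mk (Z 2 1 0) ⨟ (mk triangle).transpose)) ⨟ mk (Z 2 1 0) := by
  have h := congrArg transpose fork_eq_mirror
  rw [transpose_seq, transpose_seq, transpose_par, transpose_par, transpose_seq, transpose_mk (Z 1 2 0), transpose_mk (wires 1), transpose_mk (X 2 1 0),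
    ZXDiagram.transpose_Z, ZXDiagram.transpose_wires, ZXDiagram.transpose_X,
    transpose_seq, transpose_seq, transpose_par, transpose_par, transpose_seq, transpose_mk (Z 1 2 0), transpose_mk (wires 1), transpose_mk (X 2 1 0),
    ZXDiagram.transpose_Z, ZXDiagram.transpose_wires, ZXDiagram.transpose_X, ← seq_assoc, ← seq_assoc] at h
  exact h.symm

/-- The common core of the transistor lemmas: a red copy with a triangle leg, a plain leg and a leg merged with the
target under `Tᵗ`, all merged, is `1/√2 ⊗ ((X^{(1,2)}(π) ⊗ 𝕀) ⨾ (T ⊗ (Z^{(2,1)} ⨾ Tᵗ)) ⨾ Z^{(2,1)})`.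
[cite: JeandelPerdrixVilmart2018, Appendix Lemmas 21, 29] -/
private theorem tc_xsplit3_triangle_plain_merge_core :
    (mk (X 1 3 0) ⊠ mk (wires 1)) ⨟ (mk triangle ⊠ (mk (wires 1) ⊠ (mk (Z 2 1 0) ⨟ (mk triangle).transpose))) ⨟ mk (Z 3 1 0) = mk invSqrtTwo ⊠ ((mk (X 1 2 4) ⊠ mk (wires 1)) ⨟ (mk triangle ⊠ (mk (Z 2 1 0) ⨟ (mk triangle).transpose)) ⨟ mk (Z 2 1 0)) := by
  have hZ31 : mk (Z 3 1 0) = (mk (Z 2 1 0) ⊠ mk (wires 1)) ⨟ mk (Z 2 1 0) := by rw [Z_par_seq_Z 2 1 1 1 le_rfl, add_zero]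
  rw [← tc_xsplit_seq_xsplit_par, seq_par_wires, hZ31, ← seq_assoc _ (mk (Z 2 1 0) ⊠ mk (wires 1)) (mk (Z 2 1 0)), seq_assoc (mk (X 1 2 0) ⊠ mk (wires 1)) ((mk (X 1 2 0) ⊠ mk (wires 1)) ⊠ mk (wires 1)),
    seq_assoc (mk (X 1 2 0) ⊠ mk (wires 1)) _ (mk (Z 2 1 0) ⊠ mk (wires 1)),
    show (((mk (X 1 2 0) ⊠ mk (wires 1)) ⊠ mk (wires 1)) ⨟ (mk triangle ⊠ (mk (wires 1) ⊠ (mk (Z 2 1 0) ⨟ (mk triangle).transpose)))) ⨟ (mk (Z 2 1 0) ⊠ mk (wires 1)) = (mk (X 1 2 0) ⨟ (mk triangle ⊠ mk (wires 1)) ⨟ mk (Z 2 1 0)) ⊠ (mk (Z 2 1 0) ⨟ (mk triangle).transpose) from by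
      rw [show (mk (X 1 2 0) ⊠ mk (wires 1)) ⊠ mk (wires 1) = mk (X 1 2 0) ⊠ (mk (wires 1) ⊠ mk (wires 1)) from (par_assoc _ _ _).trans (cast_id _ _ _), wires_par_wires,
        show mk triangle ⊠ (mk (wires 1) ⊠ (mk (Z 2 1 0) ⨟ (mk triangle).transpose)) = (mk triangle ⊠ mk (wires 1)) ⊠ (mk (Z 2 1 0) ⨟ (mk triangle).transpose) from (par_assoc' _ _ _).trans (cast_id _ _ _), interchange, id_seq, interchange, seq_id],
    tc_xsplit_seq_triangle_par_seq_merge, show ∀ (s : ZXClass 0 0) (A : ZXClass 1 1) (B : ZXClass 2 1), (s ⊠ A) ⊠ B = s ⊠ (A ⊠ B) from fun s A B => (par_assoc _ _ _).trans (cast_id _ _ _),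
    show ∀ (A : ZXClass 2 3) (s : ZXClass 0 0) (B : ZXClass 3 2), A ⨟ (s ⊠ B) = s ⊠ (A ⨟ B) from fun A s B => by rw [scalar_par_seq_right, empty_par, cast_id],
    show ∀ (s : ZXClass 0 0) (A : ZXClass 2 2) (B : ZXClass 2 1), (s ⊠ A) ⨟ B = s ⊠ (A ⨟ B) from fun s A B => by rw [scalar_par_seq_left, empty_par, cast_id],
    show (mk (X 1 1 4) ⨟ mk triangle) ⊠ (mk (Z 2 1 0) ⨟ (mk triangle).transpose) = (mk (X 1 1 4) ⊠ mk (wires 2)) ⨟ (mk triangle ⊠ (mk (Z 2 1 0) ⨟ (mk triangle).transpose)) from by rw [eq_comm, interchange, id_seq],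
    ← seq_assoc (mk (X 1 2 0) ⊠ mk (wires 1)), show (mk (X 1 2 0) ⊠ mk (wires 1)) ⨟ (mk (X 1 1 4) ⊠ mk (wires 2)) = mk (X 1 2 4) ⊠ mk (wires 1) from by
      rw [← wires_par_wires 1 1, show mk (X 1 1 4) ⊠ (mk (wires 1) ⊠ mk (wires 1)) = (mk (X 1 1 4) ⊠ mk (wires 1)) ⊠ mk (wires 1) from (par_assoc' _ _ _).trans (cast_id _ _ _), interchange, seq_id,
        xsplit_seq_xphase_par]]

/-- **JPV LICS 2019, Lemma `swapped-CNOT-under-controlsep`**: a swapped CNOT (red copy of the control merged into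
the transistor's output) is absorbed into a red `π` on the transistor's copy:
`√2 ⊗ ((X^{(1,2)} ⊗ 𝕀) ⨾ (𝕀 ⊗ σ) ⨾ (τ ⊗ 𝕀) ⨾ Z^{(2,1)}) = √2 ⊗ ((X^{(1,2)}(π) ⊗ 𝕀) ⨾ (T ⊗ (Z^{(2,1)} ⨾ Tᵗ)) ⨾ Z^{(2,1)})`.
[cite: JeandelPerdrixVilmart2019, Appendix (proof of `swapped-CNOT-under-controlsep`); JeandelPerdrixVilmart2018, Appendix Lemma 29] -/
private theorem tc_swappedCNOT_under_transistor :
    mk (dumbbell 0 0) ⊠ ((mk (X 1 2 0) ⊠ mk (wires 1)) ⨟ (mk (wires 1) ⊠ mk swap) ⨟ ((mk (dumbbell 0 0) ⊠ ((mk (X 1 2 0) ⊠ mk (wires 1)) ⨟ (mk triangle ⊠ (mk (Z 2 1 0) ⨟ (mk triangle).transpose)) ⨟ mk (Z 2 1 0))) ⊠ mk (wires 1)) ⨟ mk (Z 2 1 0)) =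
      mk (dumbbell 0 0) ⊠ ((mk (X 1 2 4) ⊠ mk (wires 1)) ⨟ (mk triangle ⊠ (mk (Z 2 1 0) ⨟ (mk triangle).transpose)) ⨟ mk (Z 2 1 0)) := by
  -- fuse the two red copies
  have hXfuse : (mk (X 1 2 0) ⊠ mk (wires 1)) ⨟ (mk (wires 1) ⊠ mk swap) ⨟ ((mk (X 1 2 0) ⊠ mk (wires 1)) ⊠ mk (wires 1)) = (mk (X 1 3 0) ⊠ mk (wires 1)) ⨟ (mk (wires 2) ⊠ mk swap) := by
    rw [seq_assoc, show (mk (wires 1) ⊠ mk swap) ⨟ ((mk (X 1 2 0) ⊠ mk (wires 1)) ⊠ mk (wires 1)) = ((mk (X 1 2 0) ⊠ mk (wires 1)) ⊠ mk (wires 1)) ⨟ (mk (wires 2) ⊠ mk swap) from by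
        rw [show (mk (X 1 2 0) ⊠ mk (wires 1)) ⊠ mk (wires 1) = mk (X 1 2 0) ⊠ mk (wires 2) from by rw [← wires_par_wires 1 1]; exact (par_assoc _ _ _).trans (cast_id _ _ _),
          interchange, interchange, id_seq, seq_id, id_seq, seq_id],
      ← seq_assoc, interchange, tc_xsplit_seq_xsplit_par, seq_id]
  have hτ : ((mk (X 1 2 0) ⊠ mk (wires 1)) ⨟ (mk triangle ⊠ (mk (Z 2 1 0) ⨟ (mk triangle).transpose)) ⨟ mk (Z 2 1 0)) ⊠ mk (wires 1) = ((mk (X 1 2 0) ⊠ mk (wires 1)) ⊠ mk (wires 1)) ⨟ ((mk triangle ⊠ (mk (Z 2 1 0) ⨟ (mk triangle).transpose)) ⊠ mk (wires 1)) ⨟ (mk (Z 2 1 0) ⊠ mk (wires 1)) := by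
    rw [seq_par_wires, seq_par_wires]
  -- the final merge is symmetric: bring the plain copy next to the triangle copy
  have hZ31 : mk (Z 3 1 0) = (mk (Z 2 1 0) ⊠ mk (wires 1)) ⨟ mk (Z 2 1 0) := by rw [Z_par_seq_Z 2 1 1 1 le_rfl, add_zero]
  have hZsw : (mk (wires 1) ⊠ mk swap) ⨟ mk (Z 3 1 0) = mk (Z 3 1 0) := by
    rw [show mk (Z 3 1 0) = (mk (wires 1) ⊠ mk (Z 2 1 0)) ⨟ mk (Z 2 1 0) from by rw [par_Z_seq_Z 1 2 1 1 le_rfl, add_zero], ← seq_assoc, ← wires_par_seq, swap_seq_Z]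
  have hQsw : ((mk (Z 2 1 0) ⨟ (mk triangle).transpose) ⊠ mk (wires 1)) ⨟ mk swap = ((mk (wires 1) ⊠ mk swap) ⨟ (mk swap ⊠ mk (wires 1))) ⨟ (mk (wires 1) ⊠ (mk (Z 2 1 0) ⨟ (mk triangle).transpose)) := by
    rw [← bswap1_two, bswap1_seq_wires_par, bswap1_one]
  have hC2 : (mk (X 1 3 0) ⊠ mk (wires 1)) ⨟ (mk (wires 2) ⊠ mk swap) ⨟ ((mk triangle ⊠ (mk (Z 2 1 0) ⨟ (mk triangle).transpose)) ⊠ mk (wires 1)) ⨟ mk (Z 3 1 0) = (mk (X 1 3 0) ⊠ mk (wires 1)) ⨟ (mk triangle ⊠ (mk (wires 1) ⊠ (mk (Z 2 1 0) ⨟ (mk triangle).transpose))) ⨟ mk (Z 3 1 0) := by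
    rw [← hZsw, ← seq_assoc _ (mk (wires 1) ⊠ mk swap) (mk (Z 3 1 0)), seq_assoc _ ((mk triangle ⊠ (mk (Z 2 1 0) ⨟ (mk triangle).transpose)) ⊠ mk (wires 1)) (mk (wires 1) ⊠ mk swap),
      show ((mk triangle ⊠ (mk (Z 2 1 0) ⨟ (mk triangle).transpose)) ⊠ mk (wires 1)) ⨟ (mk (wires 1) ⊠ mk swap) = (mk (wires 1) ⊠ ((mk (wires 1) ⊠ mk swap) ⨟ (mk swap ⊠ mk (wires 1)))) ⨟ (mk triangle ⊠ (mk (wires 1) ⊠ (mk (Z 2 1 0) ⨟ (mk triangle).transpose))) from by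
        rw [show (mk triangle ⊠ (mk (Z 2 1 0) ⨟ (mk triangle).transpose)) ⊠ mk (wires 1) = mk triangle ⊠ ((mk (Z 2 1 0) ⨟ (mk triangle).transpose) ⊠ mk (wires 1)) from (par_assoc _ _ _).trans (cast_id _ _ _), interchange, seq_id, hQsw, eq_comm, interchange, id_seq],
      ← seq_assoc _ (mk (wires 1) ⊠ ((mk (wires 1) ⊠ mk swap) ⨟ (mk swap ⊠ mk (wires 1)))), seq_assoc (mk (X 1 3 0) ⊠ mk (wires 1)) (mk (wires 2) ⊠ mk swap) (mk (wires 1) ⊠ ((mk (wires 1) ⊠ mk swap) ⨟ (mk swap ⊠ mk (wires 1)))),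
      show (mk (wires 2) ⊠ mk swap) ⨟ (mk (wires 1) ⊠ ((mk (wires 1) ⊠ mk swap) ⨟ (mk swap ⊠ mk (wires 1)))) = mk (wires 1) ⊠ (mk swap ⊠ mk (wires 1)) from by
        rw [wires_par_seq, ← seq_assoc, show mk (wires 1) ⊠ (mk (wires 1) ⊠ mk swap) = mk (wires 2) ⊠ mk swap from by rw [← wires_par_wires 1 1]; exact (par_assoc' _ _ _).trans (cast_id _ _ _),
          ← wires_par_seq, swap_seq_swap, wires_par_wires, id_seq],
      show mk (wires 1) ⊠ (mk swap ⊠ mk (wires 1)) = (mk (wires 1) ⊠ mk swap) ⊠ mk (wires 1) from (par_assoc' _ _ _).trans (cast_id _ _ _), ← seq_par_wires, tc_X_one_three_seq_par_swap, hZsw]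
  rw [show ∀ (s : ZXClass 0 0) (A : ZXClass 2 1), (s ⊠ A) ⊠ mk (wires 1) = s ⊠ (A ⊠ mk (wires 1)) from fun s A => (par_assoc _ _ _).trans (cast_id _ _ _),
    show ∀ (A : ZXClass 2 3) (s : ZXClass 0 0) (B : ZXClass 3 2), A ⨟ (s ⊠ B) = s ⊠ (A ⨟ B) from fun A s B => by rw [scalar_par_seq_right, empty_par, cast_id],
    show ∀ (s : ZXClass 0 0) (A : ZXClass 2 2) (B : ZXClass 2 1), (s ⊠ A) ⨟ B = s ⊠ (A ⨟ B) from fun s A B => by rw [scalar_par_seq_left, empty_par, cast_id],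
    hτ, seq_assoc ((mk (X 1 2 0) ⊠ mk (wires 1)) ⊠ mk (wires 1)) ((mk triangle ⊠ (mk (Z 2 1 0) ⨟ (mk triangle).transpose)) ⊠ mk (wires 1)) (mk (Z 2 1 0) ⊠ mk (wires 1)), ← seq_assoc _ ((mk (X 1 2 0) ⊠ mk (wires 1)) ⊠ mk (wires 1)) _, hXfuse,
    seq_assoc _ _ (mk (Z 2 1 0)), seq_assoc ((mk triangle ⊠ (mk (Z 2 1 0) ⨟ (mk triangle).transpose)) ⊠ mk (wires 1)) (mk (Z 2 1 0) ⊠ mk (wires 1)) (mk (Z 2 1 0)), ← hZ31, ← seq_assoc _ ((mk triangle ⊠ (mk (Z 2 1 0) ⨟ (mk triangle).transpose)) ⊠ mk (wires 1)) (mk (Z 3 1 0)),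
    hC2, tc_xsplit3_triangle_plain_merge_core, sqrt_two_par_invSqrtTwo_par_two_one]
  where
  sqrt_two_par_invSqrtTwo_par_two_one (A : ZXClass 2 1) : mk (dumbbell 0 0) ⊠ (mk invSqrtTwo ⊠ A) = A := by
    rw [scalar_par_scalar_par, invSqrtTwo_par_sqrt_two_par_two_one]


/-- (Private copies `cc_*` of lemmas of `ZXCalculusTwoThroughTriangle`, whose olean the farm does not serve.)
Sliding two pieces in turn around a cup. [cite: JeandelPerdrixVilmart2018, §2.2] -/
private theorem cc_cup_slide_seq {P Q P' Q' : ZXClass 1 1} (hP : mk cup ⨟ (mk (wires 1) ⊠ P) = mk cup ⨟ (P' ⊠ mk (wires 1))) (hQ : mk cup ⨟ (mk (wires 1) ⊠ Q) = mk cup ⨟ (Q' ⊠ mk (wires 1))) :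
    mk cup ⨟ (mk (wires 1) ⊠ (P ⨟ Q)) = mk cup ⨟ ((Q' ⨟ P') ⊠ mk (wires 1)) := by
  rw [wires_par_seq, ← seq_assoc, hP, seq_assoc, slide, ← seq_assoc, hQ, seq_assoc, ← seq_par_wires]

/-- A green phase slides around the cup. [cite: JeandelPerdrixVilmart2018, §2.2] -/
private theorem cc_cup_seq_par_phase_comm (a : ZMod 8) : mk cup ⨟ (mk (wires 1) ⊠ mk (Z 1 1 a)) = mk cup ⨟ (mk (Z 1 1 a) ⊠ mk (wires 1)) := by
  rw [cup_seq_par_phase, ← cup_swap, seq_assoc, swap_seq_par_one_one, ← seq_assoc, cup_seq_par_phase, Z_seq_swap]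

/-- The gadget node of the triangle slides around the cup. [cite: JeandelPerdrixVilmart2018, §2.2] -/
private theorem cc_cup_seq_par_gadgetNode : mk cup ⨟ (mk (wires 1) ⊠ (mk (Z 1 2 0) ⨟ (mk (wires 1) ⊠ (mk (X 1 2 0) ⨟ (mk (Z 1 0 (-1)) ⊠ mk (Z 1 0 (-1))))))) = mk cup ⨟ ((mk (Z 1 2 0) ⨟ (mk (wires 1) ⊠ (mk (X 1 2 0) ⨟ (mk (Z 1 0 (-1)) ⊠ mk (Z 1 0 (-1)))))) ⊠ mk (wires 1)) := by
  rw [wires_par_seq, ← seq_assoc, ← Z_zero_three_eq_cup_par_split, seq_par_wires, ← seq_assoc, ← Z_zero_three_eq_cup_split_par,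
    show (mk (wires 1) ⊠ (mk (X 1 2 0) ⨟ (mk (Z 1 0 (-1)) ⊠ mk (Z 1 0 (-1))))) ⊠ mk (wires 1) = mk (wires 1) ⊠ ((mk (X 1 2 0) ⨟ (mk (Z 1 0 (-1)) ⊠ mk (Z 1 0 (-1)))) ⊠ mk (wires 1)) from (par_assoc _ _ _).trans (cast_id _ _ _), ← swap_seq_effect_par, wires_par_seq,
    ← seq_assoc, Z_zero_three_seq_par_swap]

/-- **The triangle slides around the cup as its transpose**: `∪ ⨾ (𝕀 ⊗ T) = ∪ ⨾ (Tᵗ ⊗ 𝕀)`. [cite: JeandelPerdrixVilmart2018, §2.2, §6] -/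
private theorem cc_cup_seq_par_triangle : mk cup ⨟ (mk (wires 1) ⊠ mk triangle) = mk cup ⨟ ((mk triangle).transpose ⊠ mk (wires 1)) := by
  have hT : mk triangle = (mk (Z 1 2 0) ⨟ (mk (wires 1) ⊠ (mk (X 1 2 0) ⨟ (mk (Z 1 0 (-1)) ⊠ mk (Z 1 0 (-1)))))) ⨟ ((mk (xLeafL 0 1) ⨟ mk (Z 1 1 1)) ⨟ mk (X 1 1 2)) := by
    rw [mk_triangle, seq_assoc, seq_assoc, ← seq_assoc (mk (xLeafL 0 1))]
  rw [triangle_transpose_explicit, hT, cc_cup_slide_seq cc_cup_seq_par_gadgetNode (cc_cup_slide_seq (cc_cup_slide_seq (cup_seq_par_xLeafL 1) (cc_cup_seq_par_phase_comm 1)) (cup_seq_par_xphase 2))]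
  simp only [seq_assoc]

/-- The transposed triangle slides around the cup as the triangle. [cite: JeandelPerdrixVilmart2018, §2.2, §6] -/
private theorem cc_cup_seq_par_triangleT : mk cup ⨟ (mk (wires 1) ⊠ (mk triangle).transpose) = mk cup ⨟ (mk triangle ⊠ mk (wires 1)) := by
  rw [← cup_swap, seq_assoc, swap_seq_par_phase, ← seq_assoc, ← cc_cup_seq_par_triangle, seq_assoc, ← swap_seq_par_one_one, ← seq_assoc, cup_swap]

/-- `Tᵗ` slides around a cap as `T`: `(𝕀 ⊗ Tᵗ) ⨾ ∩ = (T ⊗ 𝕀) ⨾ ∩` (transpose of the cup version). [cite: JeandelPerdrixVilmart2018, §2.2, §6] -/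
theorem par_Tt_seq_cap : mk (wires 1) ⊠ (mk triangle).transpose ⨟ mk cap = mk triangle ⊠ mk (wires 1) ⨟ mk cap := by
  have h := congrArg transpose cc_cup_seq_par_triangle
  simpa using h

/-- **The switch is the target-transpose of the transistor**: bending the transistor core `√2 ⊗ ((X^{(1,2)} ⊗ 𝕀) ⨾ (T ⊗ (Z^{(2,1)} ⨾ Tᵗ)) ⨾ Z^{(2,1)})` with a cup feeding its target and a cap on its output gives `sw`: `(𝕀² ⊗ ∪) ⨾ ((𝕀 ⊗ τ) ⊗ 𝕀) ⨾ (∩ ⊗ 𝕀) = sw`. [cite: JeandelPerdrixVilmart2019, §3.1 (the transistor and its upside-down form); JeandelPerdrixVilmart2018, §2.2 (only the topology matters)] -/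
theorem flat_core_eq_switch : mk (wires 2) ⊠ mk cup ⨟ mk (wires 1) ⊠ (mk (dumbbell 0 0) ⊠ (mk (X 1 2 0) ⊠ mk (wires 1) ⨟ mk triangle ⊠ (mk (Z 2 1 0) ⨟ (mk triangle).transpose) ⨟ mk (Z 2 1 0))) ⊠ mk (wires 1) ⨟ mk cap ⊠ mk (wires 1) = mk switch := by
  have s0 : mk (wires 2) ⊠ mk cup ⨟ mk (wires 1) ⊠ (mk (dumbbell 0 0) ⊠ (mk (X 1 2 0) ⊠ mk (wires 1) ⨟ mk triangle ⊠ (mk (Z 2 1 0) ⨟ (mk triangle).transpose) ⨟ mk (Z 2 1 0))) ⊠ mk (wires 1) ⨟ mk cap ⊠ mk (wires 1) = _ := cgl (cgr (_ : ZXClass 2 4) (cpl (show mk (wires 1) ⊠ (mk (dumbbell 0 0) ⊠ (mk (X 1 2 0) ⊠ mk (wires 1) ⨟ mk triangle ⊠ (mk (Z 2 1 0) ⨟ (mk triangle).transpose) ⨟ mk (Z 2 1 0))) = mk (dumbbell 0 0) ⊠ (mk (wires 1) ⊠ (mk (X 1 2 0) ⊠ mk (wires 1) ⨟ mk triangle ⊠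 (mk (Z 2 1 0) ⨟ (mk triangle).transpose) ⨟ mk (Z 2 1 0))) from ((par_assoc' _ _ _).trans (cast_id _ _ _)).trans ((cpl (scalar_par_wires _).symm _).trans ((par_assoc _ _ _).trans (cast_id _ _ _)))) (_ : ZXClass 1 1))) (_ : ZXClass 3 1)  -- scalar
  have s1 := s0.trans (cgl (cgr (_ : ZXClass 2 4) (show mk (dumbbell 0 0) ⊠ (mk (wires 1) ⊠ (mk (X 1 2 0) ⊠ mk (wires 1) ⨟ mk triangle ⊠ (mk (Z 2 1 0) ⨟ (mk triangle).transpose) ⨟ mk (Z 2 1 0))) ⊠ mk (wires 1) = mk (dumbbell 0 0) ⊠ (mk (wires 1) ⊠ (mk (X 1 2 0) ⊠ mk (wires 1) ⨟ mk triangle ⊠ (mk (Z 2 1 0) ⨟ (mk triangle).transpose) ⨟ mk (Z 2 1 0)) ⊠ mk (wires 1)) from (par_assoc _ _ _).trans (cast_id _ _ _))) (_ : ZXClass 3 1))  -- scalar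
  have s2 := s1.trans (cgl (show mk (wires 2) ⊠ mk cup ⨟ mk (dumbbell 0 0) ⊠ (mk (wires 1) ⊠ (mk (X 1 2 0) ⊠ mk (wires 1) ⨟ mk triangle ⊠ (mk (Z 2 1 0) ⨟ (mk triangle).transpose) ⨟ mk (Z 2 1 0)) ⊠ mk (wires 1)) = mk (dumbbell 0 0) ⊠ (mk (wires 2) ⊠ mk cup ⨟ mk (wires 1) ⊠ (mk (X 1 2 0) ⊠ mk (wires 1) ⨟ mk triangle ⊠ (mk (Z 2 1 0) ⨟ (mk triangle).transpose) ⨟ mk (Z 2 1 0)) ⊠ mk (wires 1)) from by rw [scalar_par_seq_right (mk (dumbbell 0 0)) (mk (wires 2) ⊠ mk cup) (mk (wires 1) ⊠ (mk (X 1 2 0) ⊠ mk (wires 1) ⨟ mk triangle ⊠ (mk (Z 2 1 0) ⨟ (mk triangle).transpose) ⨟ mk (Z 2 1 0)) ⊠ mk (wires 1)), empty_par, cast_id]) (_ : ZXClass 3 1))  -- scalar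
  have s3 := s2.trans ((show mk (dumbbell 0 0) ⊠ (mk (wires 2) ⊠ mk cup ⨟ mk (wires 1) ⊠ (mk (X 1 2 0) ⊠ mk (wires 1) ⨟ mk triangle ⊠ (mk (Z 2 1 0) ⨟ (mk triangle).transpose) ⨟ mk (Z 2 1 0)) ⊠ mk (wires 1)) ⨟ mk cap ⊠ mk (wires 1) = mk (dumbbell 0 0) ⊠ (mk (wires 2) ⊠ mk cup ⨟ mk (wires 1) ⊠ (mk (X 1 2 0) ⊠ mk (wires 1) ⨟ mk triangle ⊠ (mk (Z 2 1 0) ⨟ (mk triangle).transpose) ⨟ mk (Z 2 1 0)) ⊠ mk (wires 1) ⨟ mk cap ⊠ mk (wires 1)) from by rw [scalar_par_seq_left (mk (dumbbell 0 0)) (mk (wires 2) ⊠ mk cup ⨟ mk (wires 1) ⊠ (mk (X 1 2 0) ⊠ mk (wires 1) ⨟ mk triangle ⊠ (mk (Z 2 1 0) ⨟ (mk triangle).transpose) ⨟ mk (Z 2 1 0)) ⊠ mk (wires 1)) (mk cap ⊠ mk (wires 1)), empty_par, cast_id]))  -- scalar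
  have s4 := s3.trans (cpr (_ : ZXClass 0 0) (cgl (cgr (_ : ZXClass 2 4) (cpl (show mk (wires 1) ⊠ (mk (X 1 2 0) ⊠ mk (wires 1) ⨟ mk triangle ⊠ (mk (Z 2 1 0) ⨟ (mk triangle).transpose) ⨟ mk (Z 2 1 0)) = mk (wires 1) ⊠ (mk (X 1 2 0) ⊠ mk (wires 1)) ⨟ mk (wires 1) ⊠ (mk triangle ⊠ (mk (Z 2 1 0) ⨟ (mk triangle).transpose)) ⨟ mk (wires 1) ⊠ mk (Z 2 1 0) from by simp only [wires_par_seq]) (_ : ZXClass 1 1))) (_ : ZXClass 3 1)))  -- wires_par_seq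
  have s5 := s4.trans (cpr (_ : ZXClass 0 0) (cgl (cgr (_ : ZXClass 2 4) (show (mk (wires 1) ⊠ (mk (X 1 2 0) ⊠ mk (wires 1)) ⨟ mk (wires 1) ⊠ (mk triangle ⊠ (mk (Z 2 1 0) ⨟ (mk triangle).transpose)) ⨟ mk (wires 1) ⊠ mk (Z 2 1 0)) ⊠ mk (wires 1) = mk (wires 1) ⊠ (mk (X 1 2 0) ⊠ mk (wires 1)) ⊠ mk (wires 1) ⨟ mk (wires 1) ⊠ (mk triangle ⊠ (mk (Z 2 1 0) ⨟ (mk triangle).transpose)) ⊠ mk (wires 1) ⨟ mk (wires 1) ⊠ mk (Z 2 1 0) ⊠ mk (wires 1) from by simp only [seq_par_wires])) (_ : ZXClass 3 1)))  -- seq_par_wires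
  have s6 := s5.trans (cpr (_ : ZXClass 0 0) (show mk (wires 2) ⊠ mk cup ⨟ (mk (wires 1) ⊠ (mk (X 1 2 0) ⊠ mk (wires 1)) ⊠ mk (wires 1) ⨟ mk (wires 1) ⊠ (mk triangle ⊠ (mk (Z 2 1 0) ⨟ (mk triangle).transpose)) ⊠ mk (wires 1) ⨟ mk (wires 1) ⊠ mk (Z 2 1 0) ⊠ mk (wires 1)) ⨟ mk cap ⊠ mk (wires 1) = mk (wires 2) ⊠ mk cup ⨟ mk (wires 1) ⊠ (mk (X 1 2 0) ⊠ mk (wires 1)) ⊠ mk (wires 1) ⨟ mk (wires 1) ⊠ (mk triangle ⊠ (mk (Z 2 1 0) ⨟ (mk triangle).transpose)) ⊠ mk (wires 1) ⨟ mk (wires 1) ⊠ mk (Z 2 1 0) ⊠ mk (wires 1) ⨟ mk cap ⊠ mk (wires 1) from by simp only [seq_assoc]))  -- assoc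
  have s7 := s6.trans (cpr (_ : ZXClass 0 0) (cgl (cgl (cgl (cgr (_ : ZXClass 2 4) (cpl (show mk (wires 1) ⊠ (mk (X 1 2 0) ⊠ mk (wires 1)) = mk (wires 1) ⊠ mk (X 1 2 0) ⊠ mk (wires 1) from (par_assoc' _ _ _).trans (cast_id _ _ _)) (_ : ZXClass 1 1))) (_ : ZXClass 5 4)) (_ : ZXClass 4 3)) (_ : ZXClass 3 1)))  -- par_assoc
  have s8 := s7.trans (cpr (_ : ZXClass 0 0) (cgl (cgl (cgl (cgr (_ : ZXClass 2 4) (show mk (wires 1) ⊠ mk (X 1 2 0) ⊠ mk (wires 1) ⊠ mk (wires 1) = mk (wires 1) ⊠ mk (X 1 2 0) ⊠ (mk (wires 1) ⊠ mk (wires 1)) from (par_assoc _ _ _).trans (cast_id _ _ _))) (_ : ZXClass 5 4)) (_ : ZXClass 4 3)) (_ : ZXClass 3 1)))  -- par_assoc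
  have s9 := s8.trans (cpr (_ : ZXClass 0 0) (cgl (cgl (cgl (cgr (_ : ZXClass 2 4) (cpr (_ : ZXClass 2 3) (show mk (wires 1) ⊠ mk (wires 1) = mk (wires 2) from wires_par_wires 1 1))) (_ : ZXClass 5 4)) (_ : ZXClass 4 3)) (_ : ZXClass 3 1)))  -- wires
  have s10 := s9.trans (cpr (_ : ZXClass 0 0) (cgl (cgl (cgl (show mk (wires 2) ⊠ mk cup ⨟ mk (wires 1) ⊠ mk (X 1 2 0) ⊠ mk (wires 2) = mk (wires 1) ⊠ mk (X 1 2 0) ⊠ mk (wires 0) ⨟ mk (wires 3) ⊠ mk cup from (slide _ _).symm) (_ : ZXClass 5 4)) (_ : ZXClass 4 3)) (_ : ZXClass 3 1)))  -- slide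
  have s11 := s10.trans (cpr (_ : ZXClass 0 0) (cgl (cgl (cgl (cgl (show mk (wires 1) ⊠ mk (X 1 2 0) ⊠ mk (wires 0) = mk (wires 1) ⊠ mk (X 1 2 0) from par_empty _) (_ : ZXClass 3 5)) (_ : ZXClass 5 4)) (_ : ZXClass 4 3)) (_ : ZXClass 3 1)))  -- par_empty
  have s12 := s11.trans (cpr (_ : ZXClass 0 0) (cgl (cgl (cgr (_ : ZXClass 2 5) (cpl (cpr (_ : ZXClass 1 1) (show mk triangle ⊠ (mk (Z 2 1 0) ⨟ (mk triangle).transpose) = mk triangle ⊠ mk (wires 2) ⨟ mk (wires 1) ⊠ (mk (Z 2 1 0) ⨟ (mk triangle).transpose) from par_eq_seq_left _ _)) (_ : ZXClass 1 1))) (_ : ZXClass 4 3)) (_ : ZXClass 3 1)))  -- par_eq_seq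
  have s13 := s12.trans (cpr (_ : ZXClass 0 0) (cgl (cgl (cgr (_ : ZXClass 2 5) (cpl (show mk (wires 1) ⊠ (mk triangle ⊠ mk (wires 2) ⨟ mk (wires 1) ⊠ (mk (Z 2 1 0) ⨟ (mk triangle).transpose)) = mk (wires 1) ⊠ (mk triangle ⊠ mk (wires 2)) ⨟ mk (wires 1) ⊠ (mk (wires 1) ⊠ (mk (Z 2 1 0) ⨟ (mk triangle).transpose)) from by simp only [wires_par_seq]) (_ : ZXClass 1 1))) (_ : ZXClass 4 3)) (_ : ZXClass 3 1)))  -- wires_par_seq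
  have s14 := s13.trans (cpr (_ : ZXClass 0 0) (cgl (cgl (cgr (_ : ZXClass 2 5) (show (mk (wires 1) ⊠ (mk triangle ⊠ mk (wires 2)) ⨟ mk (wires 1) ⊠ (mk (wires 1) ⊠ (mk (Z 2 1 0) ⨟ (mk triangle).transpose))) ⊠ mk (wires 1) = mk (wires 1) ⊠ (mk triangle ⊠ mk (wires 2)) ⊠ mk (wires 1) ⨟ mk (wires 1) ⊠ (mk (wires 1) ⊠ (mk (Z 2 1 0) ⨟ (mk triangle).transpose)) ⊠ mk (wires 1) from by simp only [seq_par_wires])) (_ : ZXClass 4 3)) (_ : ZXClass 3 1)))  -- seq_par_wires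
  have s15 := s14.trans (cpr (_ : ZXClass 0 0) (show mk (wires 1) ⊠ mk (X 1 2 0) ⨟ mk (wires 3) ⊠ mk cup ⨟ (mk (wires 1) ⊠ (mk triangle ⊠ mk (wires 2)) ⊠ mk (wires 1) ⨟ mk (wires 1) ⊠ (mk (wires 1) ⊠ (mk (Z 2 1 0) ⨟ (mk triangle).transpose)) ⊠ mk (wires 1)) ⨟ mk (wires 1) ⊠ mk (Z 2 1 0) ⊠ mk (wires 1) ⨟ mk cap ⊠ mk (wires 1) = mk (wires 1) ⊠ mk (X 1 2 0) ⨟ mk (wires 3) ⊠ mk cup ⨟ mk (wires 1) ⊠ (mk triangle ⊠ mk (wires 2)) ⊠ mk (wires 1) ⨟ mk (wires 1) ⊠ (mk (wires 1) ⊠ (mk (Z 2 1 0) ⨟ (mk triangle).transpose)) ⊠ mk (wires 1) ⨟ mk (wires 1) ⊠ mk (Z 2 1 0) ⊠ mk (wires 1) ⨟ mk cap ⊠ mk (wires 1) from by simp only [seq_assoc]))  -- assoc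
  have s16 := s15.trans (cpr (_ : ZXClass 0 0) (cgl (cgl (cgr (_ : ZXClass 2 5) (cpl (show mk (wires 1) ⊠ (mk (wires 1) ⊠ (mk (Z 2 1 0) ⨟ (mk triangle).transpose)) = mk (wires 1) ⊠ mk (wires 1) ⊠ (mk (Z 2 1 0) ⨟ (mk triangle).transpose) from (par_assoc' _ _ _).trans (cast_id _ _ _)) (_ : ZXClass 1 1))) (_ : ZXClass 4 3)) (_ : ZXClass 3 1)))  -- par_assoc
  have s17 := s16.trans (cpr (_ : ZXClass 0 0) (cgl (cgl (cgr (_ : ZXClass 2 5) (cpl (cpl (show mk (wires 1) ⊠ mk (wires 1) = mk (wires 2) from wires_par_wires 1 1) (_ : ZXClass 2 1)) (_ : ZXClass 1 1))) (_ : ZXClass 4 3)) (_ : ZXClass 3 1)))  -- wires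
  have s18 := s17.trans (cpr (_ : ZXClass 0 0) (cgl (cgl (cgr (_ : ZXClass 2 5) (show mk (wires 2) ⊠ (mk (Z 2 1 0) ⨟ (mk triangle).transpose) ⊠ mk (wires 1) = mk (wires 2) ⊠ ((mk (Z 2 1 0) ⨟ (mk triangle).transpose) ⊠ mk (wires 1)) from (par_assoc _ _ _).trans (cast_id _ _ _))) (_ : ZXClass 4 3)) (_ : ZXClass 3 1)))  -- par_assoc
  have s19 := s18.trans (cpr (_ : ZXClass 0 0) (cgl (cgl (cgr (_ : ZXClass 2 5) (cpr (_ : ZXClass 2 2) (show (mk (Z 2 1 0) ⨟ (mk triangle).transpose) ⊠ mk (wires 1) = mk (Z 2 1 0) ⊠ mk (wires 1) ⨟ (mk triangle).transpose ⊠ mk (wires 1) from by simp only [seq_par_wires]))) (_ : ZXClass 4 3)) (_ : ZXClass 3 1)))  -- seq_par_wires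
  have s20 := s19.trans (cpr (_ : ZXClass 0 0) (cgl (cgl (cgr (_ : ZXClass 2 5) (show mk (wires 2) ⊠ (mk (Z 2 1 0) ⊠ mk (wires 1) ⨟ (mk triangle).transpose ⊠ mk (wires 1)) = mk (wires 2) ⊠ (mk (Z 2 1 0) ⊠ mk (wires 1)) ⨟ mk (wires 2) ⊠ ((mk triangle).transpose ⊠ mk (wires 1)) from by simp only [wires_par_seq])) (_ : ZXClass 4 3)) (_ : ZXClass 3 1)))  -- wires_par_seq
  have s21 := s20.trans (cpr (_ : ZXClass 0 0) (show mk (wires 1) ⊠ mk (X 1 2 0) ⨟ mk (wires 3) ⊠ mk cup ⨟ mk (wires 1) ⊠ (mk triangle ⊠ mk (wires 2)) ⊠ mk (wires 1) ⨟ (mk (wires 2) ⊠ (mk (Z 2 1 0) ⊠ mk (wires 1)) ⨟ mk (wires 2) ⊠ ((mk triangle).transpose ⊠ mk (wires 1))) ⨟ mk (wires 1) ⊠ mk (Z 2 1 0) ⊠ mk (wires 1) ⨟ mk cap ⊠ mk (wires 1) = mk (wires 1) ⊠ mk (X 1 2 0) ⨟ mk (wires 3) ⊠ mk cup ⨟ mk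 (wires 1) ⊠ (mk triangle ⊠ mk (wires 2)) ⊠ mk (wires 1) ⨟ mk (wires 2) ⊠ (mk (Z 2 1 0) ⊠ mk (wires 1)) ⨟ mk (wires 2) ⊠ ((mk triangle).transpose ⊠ mk (wires 1)) ⨟ mk (wires 1) ⊠ mk (Z 2 1 0) ⊠ mk (wires 1) ⨟ mk cap ⊠ mk (wires 1) from by simp only [seq_assoc]))  -- assoc
  have s22 := s21.trans (cpr (_ : ZXClass 0 0) (cgl (cgl (cgl (cgl (cgr (_ : ZXClass 2 5) (cpl (cpr (_ : ZXClass 1 1) (cpr (_ : ZXClass 1 1) (show mk (wires 2) = mk (wires 1) ⊠ mk (wires 1) from (wires_par_wires 1 1).symm))) (_ : ZXClass 1 1))) (_ : ZXClass 5 4)) (_ : ZXClass 4 4)) (_ : ZXClass 4 3)) (_ : ZXClass 3 1)))  -- wires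
  have s23 := s22.trans (cpr (_ : ZXClass 0 0) (cgl (cgl (cgl (cgl (cgr (_ : ZXClass 2 5) (cpl (cpr (_ : ZXClass 1 1) (show mk triangle ⊠ (mk (wires 1) ⊠ mk (wires 1)) = mk triangle ⊠ mk (wires 1) ⊠ mk (wires 1) from (par_assoc' _ _ _).trans (cast_id _ _ _))) (_ : ZXClass 1 1))) (_ : ZXClass 5 4)) (_ : ZXClass 4 4)) (_ : ZXClass 4 3)) (_ : ZXClass 3 1)))  -- par_assoc
  have s24 := s23.trans (cpr (_ : ZXClass 0 0) (cgl (cgl (cgl (cgl (cgr (_ : ZXClass 2 5) (cpl (show mk (wires 1) ⊠ (mk triangle ⊠ mk (wires 1) ⊠ mk (wires 1)) = mk (wires 1) ⊠ (mk triangle ⊠ mk (wires 1)) ⊠ mk (wires 1) from (par_assoc' _ _ _).trans (cast_id _ _ _)) (_ : ZXClass 1 1))) (_ : ZXClass 5 4)) (_ : ZXClass 4 4)) (_ : ZXClass 4 3)) (_ : ZXClass 3 1)))  -- par_assoc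
  have s25 := s24.trans (cpr (_ : ZXClass 0 0) (cgl (cgl (cgl (cgl (cgr (_ : ZXClass 2 5) (show mk (wires 1) ⊠ (mk triangle ⊠ mk (wires 1)) ⊠ mk (wires 1) ⊠ mk (wires 1) = mk (wires 1) ⊠ (mk triangle ⊠ mk (wires 1)) ⊠ (mk (wires 1) ⊠ mk (wires 1)) from (par_assoc _ _ _).trans (cast_id _ _ _))) (_ : ZXClass 5 4)) (_ : ZXClass 4 4)) (_ : ZXClass 4 3)) (_ : ZXClass 3 1)))  -- par_assoc
  have s26 := s25.trans (cpr (_ : ZXClass 0 0) (cgl (cgl (cgl (cgl (cgr (_ : ZXClass 2 5) (cpr (_ : ZXClass 3 3) (show mk (wires 1) ⊠ mk (wires 1) = mk (wires 2) from wires_par_wires 1 1))) (_ : ZXClass 5 4)) (_ : ZXClass 4 4)) (_ : ZXClass 4 3)) (_ : ZXClass 3 1)))  -- wires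
  have s27 := s26.trans (cpr (_ : ZXClass 0 0) (cgl (cgl (cgl (cgl (show mk (wires 1) ⊠ mk (X 1 2 0) ⨟ mk (wires 3) ⊠ mk cup ⨟ mk (wires 1) ⊠ (mk triangle ⊠ mk (wires 1)) ⊠ mk (wires 2) = mk (wires 1) ⊠ mk (X 1 2 0) ⨟ (mk (wires 3) ⊠ mk cup ⨟ mk (wires 1) ⊠ (mk triangle ⊠ mk (wires 1)) ⊠ mk (wires 2)) from by simp only [seq_assoc]) (_ : ZXClass 5 4)) (_ : ZXClass 4 4)) (_ : ZXClass 4 3)) (_ : ZXClass 3 1)))  -- assoc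
  have s28 := s27.trans (cpr (_ : ZXClass 0 0) (cgl (cgl (cgl (cgl (cgr (_ : ZXClass 2 3) (show mk (wires 3) ⊠ mk cup ⨟ mk (wires 1) ⊠ (mk triangle ⊠ mk (wires 1)) ⊠ mk (wires 2) = mk (wires 1) ⊠ (mk triangle ⊠ mk (wires 1)) ⊠ mk (wires 0) ⨟ mk (wires 3) ⊠ mk cup from (slide _ _).symm)) (_ : ZXClass 5 4)) (_ : ZXClass 4 4)) (_ : ZXClass 4 3)) (_ : ZXClass 3 1)))  -- slide
  have s29 := s28.trans (cpr (_ : ZXClass 0 0) (cgl (cgl (cgl (cgl (cgr (_ : ZXClass 2 3) (cgl (show mk (wires 1) ⊠ (mk triangle ⊠ mk (wires 1)) ⊠ mk (wires 0) = mk (wires 1) ⊠ (mk triangle ⊠ mk (wires 1)) from par_empty _) (_ : ZXClass 3 5))) (_ : ZXClass 5 4)) (_ : ZXClass 4 4)) (_ : ZXClass 4 3)) (_ : ZXClass 3 1)))  -- par_empty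
  have s30 := s29.trans (cpr (_ : ZXClass 0 0) (show mk (wires 1) ⊠ mk (X 1 2 0) ⨟ (mk (wires 1) ⊠ (mk triangle ⊠ mk (wires 1)) ⨟ mk (wires 3) ⊠ mk cup) ⨟ mk (wires 2) ⊠ (mk (Z 2 1 0) ⊠ mk (wires 1)) ⨟ mk (wires 2) ⊠ ((mk triangle).transpose ⊠ mk (wires 1)) ⨟ mk (wires 1) ⊠ mk (Z 2 1 0) ⊠ mk (wires 1) ⨟ mk cap ⊠ mk (wires 1) = mk (wires 1) ⊠ mk (X 1 2 0) ⨟ mk (wires 1) ⊠ (mk triangle ⊠ mk (wires 1)) ⨟ mk (wires 3) ⊠ mk cup ⨟ mk (wires 2) ⊠ (mk (Z 2 1 0) ⊠ mk (wires 1)) ⨟ mk (wires 2) ⊠ ((mk triangle).transpose ⊠ mk (wires 1)) ⨟ mk (wires 1) ⊠ mk (Z 2 1 0) ⊠ mk (wires 1) ⨟ mk cap ⊠ mk (wires 1) from by simp only [seq_assoc]))  -- assoc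
  have s31 := s30.trans (cpr (_ : ZXClass 0 0) (cgl (cgl (cgl (cgl (cgr (_ : ZXClass 2 3) (cpl (show mk (wires 3) = mk (wires 2) ⊠ mk (wires 1) from (wires_par_wires 2 1).symm) (_ : ZXClass 0 2))) (_ : ZXClass 5 4)) (_ : ZXClass 4 4)) (_ : ZXClass 4 3)) (_ : ZXClass 3 1)))  -- wires
  have s32 := s31.trans (cpr (_ : ZXClass 0 0) (cgl (cgl (cgl (cgl (cgr (_ : ZXClass 2 3) (show mk (wires 2) ⊠ mk (wires 1) ⊠ mk cup = mk (wires 2) ⊠ (mk (wires 1) ⊠ mk cup) from (par_assoc _ _ _).trans (cast_id _ _ _))) (_ : ZXClass 5 4)) (_ : ZXClass 4 4)) (_ : ZXClass 4 3)) (_ : ZXClass 3 1)))  -- par_assoc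
  have s33 := s32.trans (cpr (_ : ZXClass 0 0) (cgl (cgl (cgl (show mk (wires 1) ⊠ mk (X 1 2 0) ⨟ mk (wires 1) ⊠ (mk triangle ⊠ mk (wires 1)) ⨟ mk (wires 2) ⊠ (mk (wires 1) ⊠ mk cup) ⨟ mk (wires 2) ⊠ (mk (Z 2 1 0) ⊠ mk (wires 1)) = mk (wires 1) ⊠ mk (X 1 2 0) ⨟ mk (wires 1) ⊠ (mk triangle ⊠ mk (wires 1)) ⨟ (mk (wires 2) ⊠ (mk (wires 1) ⊠ mk cup) ⨟ mk (wires 2) ⊠ (mk (Z 2 1 0) ⊠ mk (wires 1))) from by simp only [seq_assoc]) (_ : ZXClass 4 4)) (_ : ZXClass 4 3)) (_ : ZXClass 3 1)))  -- assoc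
  have s34 := s33.trans (cpr (_ : ZXClass 0 0) (cgl (cgl (cgl (cgr (_ : ZXClass 2 3) (show mk (wires 2) ⊠ (mk (wires 1) ⊠ mk cup) ⨟ mk (wires 2) ⊠ (mk (Z 2 1 0) ⊠ mk (wires 1)) = mk (wires 2) ⊠ (mk (wires 1) ⊠ mk cup ⨟ mk (Z 2 1 0) ⊠ mk (wires 1)) from (wires_par_seq 2 _ _).symm)) (_ : ZXClass 4 4)) (_ : ZXClass 4 3)) (_ : ZXClass 3 1)))  -- wires_par_seq
  have s35 := s34.trans (cpr (_ : ZXClass 0 0) (cgl (cgl (cgl (cgr (_ : ZXClass 2 3) (cpr (_ : ZXClass 2 2) (show mk (wires 1) ⊠ mk cup ⨟ mk (Z 2 1 0) ⊠ mk (wires 1) = mk (Z 1 2 0) from par_cup_seq_merge_par))) (_ : ZXClass 4 4)) (_ : ZXClass 4 3)) (_ : ZXClass 3 1)))  -- par_cup_seq_merge_par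
  have s36 := s35.trans (cpr (_ : ZXClass 0 0) (show mk (wires 1) ⊠ mk (X 1 2 0) ⨟ mk (wires 1) ⊠ (mk triangle ⊠ mk (wires 1)) ⨟ mk (wires 2) ⊠ mk (Z 1 2 0) ⨟ mk (wires 2) ⊠ ((mk triangle).transpose ⊠ mk (wires 1)) ⨟ mk (wires 1) ⊠ mk (Z 2 1 0) ⊠ mk (wires 1) ⨟ mk cap ⊠ mk (wires 1) = mk (wires 1) ⊠ mk (X 1 2 0) ⨟ mk (wires 1) ⊠ (mk triangle ⊠ mk (wires 1)) ⨟ mk (wires 2) ⊠ mk (Z 1 2 0) ⨟ mk (wires 2) ⊠ ((mk triangle).transpose ⊠ mk (wires 1)) ⨟ (mk (wires 1) ⊠ mk (Z 2 1 0) ⊠ mk (wires 1) ⨟ mk cap ⊠ mk (wires 1)) from by simp only [seq_assoc]))  -- assoc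
  have s37 := s36.trans (cpr (_ : ZXClass 0 0) (cgr (_ : ZXClass 2 4) (show mk (wires 1) ⊠ mk (Z 2 1 0) ⊠ mk (wires 1) ⨟ mk cap ⊠ mk (wires 1) = (mk (wires 1) ⊠ mk (Z 2 1 0) ⨟ mk cap) ⊠ mk (wires 1) from (seq_par_wires _ _ 1).symm)))  -- seq_par_wires
  have s38 := s37.trans (cpr (_ : ZXClass 0 0) (cgr (_ : ZXClass 2 4) (cpl (cgr (_ : ZXClass 3 2) (show mk cap = mk (Z 2 0 0) from (Z_two_zero).symm)) (_ : ZXClass 1 1))))  -- Z_two_zero⁻¹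
  have s39 := s38.trans (cpr (_ : ZXClass 0 0) (cgr (_ : ZXClass 2 4) (cpl (show mk (wires 1) ⊠ mk (Z 2 1 0) ⨟ mk (Z 2 0 0) = mk (Z 3 0 0) from (par_Z_seq_Z 1 2 1 0 le_rfl 0 0)) (_ : ZXClass 1 1))))  -- par_Z21_seq_Z20
  have s40 := s39.trans (cpr (_ : ZXClass 0 0) (cgr (_ : ZXClass 2 4) (cpl (show mk (Z 3 0 0) = mk (Z 2 1 0) ⊠ mk (wires 1) ⨟ mk cap from (merge_par_seq_cap).symm) (_ : ZXClass 1 1))))  -- Z21_par_seq_cap⁻¹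
  have s41 := s40.trans (cpr (_ : ZXClass 0 0) (cgr (_ : ZXClass 2 4) (show (mk (Z 2 1 0) ⊠ mk (wires 1) ⨟ mk cap) ⊠ mk (wires 1) = mk (Z 2 1 0) ⊠ mk (wires 1) ⊠ mk (wires 1) ⨟ mk cap ⊠ mk (wires 1) from by simp only [seq_par_wires])))  -- seq_par_wires
  have s42 := s41.trans (cpr (_ : ZXClass 0 0) (show mk (wires 1) ⊠ mk (X 1 2 0) ⨟ mk (wires 1) ⊠ (mk triangle ⊠ mk (wires 1)) ⨟ mk (wires 2) ⊠ mk (Z 1 2 0) ⨟ mk (wires 2) ⊠ ((mk triangle).transpose ⊠ mk (wires 1)) ⨟ (mk (Z 2 1 0) ⊠ mk (wires 1) ⊠ mk (wires 1) ⨟ mk cap ⊠ mk (wires 1)) = mk (wires 1) ⊠ mk (X 1 2 0) ⨟ mk (wires 1) ⊠ (mk triangle ⊠ mk (wires 1)) ⨟ mk (wires 2) ⊠ mk (Z 1 2 0) ⨟ mk (wires 2) ⊠ ((mk triangle).transpose ⊠ mk (wires 1)) ⨟ mk (Z 2 1 0) ⊠ mk (wires 1) ⊠ mk (wires 1) ⨟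 mk cap ⊠ mk (wires 1) from by simp only [seq_assoc]))  -- assoc
  have s43 := s42.trans (cpr (_ : ZXClass 0 0) (cgl (cgr (_ : ZXClass 2 4) (show mk (Z 2 1 0) ⊠ mk (wires 1) ⊠ mk (wires 1) = mk (Z 2 1 0) ⊠ (mk (wires 1) ⊠ mk (wires 1)) from (par_assoc _ _ _).trans (cast_id _ _ _))) (_ : ZXClass 3 1)))  -- par_assoc
  have s44 := s43.trans (cpr (_ : ZXClass 0 0) (cgl (cgr (_ : ZXClass 2 4) (cpr (_ : ZXClass 2 1) (show mk (wires 1) ⊠ mk (wires 1) = mk (wires 2) from wires_par_wires 1 1))) (_ : ZXClass 3 1)))  -- wires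
  have s45 := s44.trans (cpr (_ : ZXClass 0 0) (cgl (show mk (wires 1) ⊠ mk (X 1 2 0) ⨟ mk (wires 1) ⊠ (mk triangle ⊠ mk (wires 1)) ⨟ mk (wires 2) ⊠ mk (Z 1 2 0) ⨟ mk (wires 2) ⊠ ((mk triangle).transpose ⊠ mk (wires 1)) ⨟ mk (Z 2 1 0) ⊠ mk (wires 2) = mk (wires 1) ⊠ mk (X 1 2 0) ⨟ mk (wires 1) ⊠ (mk triangle ⊠ mk (wires 1)) ⨟ mk (wires 2) ⊠ mk (Z 1 2 0) ⨟ (mk (wires 2) ⊠ ((mk triangle).transpose ⊠ mk (wires 1)) ⨟ mk (Z 2 1 0) ⊠ mk (wires 2)) from by simp only [seq_assoc]) (_ : ZXClass 3 1)))  -- assoc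
  have s46 := s45.trans (cpr (_ : ZXClass 0 0) (cgl (cgr (_ : ZXClass 2 4) (show mk (wires 2) ⊠ ((mk triangle).transpose ⊠ mk (wires 1)) ⨟ mk (Z 2 1 0) ⊠ mk (wires 2) = mk (Z 2 1 0) ⊠ mk (wires 2) ⨟ mk (wires 1) ⊠ ((mk triangle).transpose ⊠ mk (wires 1)) from (slide _ _).symm)) (_ : ZXClass 3 1)))  -- slide
  have s47 := s46.trans (cpr (_ : ZXClass 0 0) (show mk (wires 1) ⊠ mk (X 1 2 0) ⨟ mk (wires 1) ⊠ (mk triangle ⊠ mk (wires 1)) ⨟ mk (wires 2) ⊠ mk (Z 1 2 0) ⨟ (mk (Z 2 1 0) ⊠ mk (wires 2) ⨟ mk (wires 1) ⊠ ((mk triangle).transpose ⊠ mk (wires 1))) ⨟ mk cap ⊠ mk (wires 1) = mk (wires 1) ⊠ mk (X 1 2 0) ⨟ mk (wires 1) ⊠ (mk triangle ⊠ mk (wires 1)) ⨟ mk (wires 2) ⊠ mk (Z 1 2 0) ⨟ mk (Z 2 1 0) ⊠ mk (wires 2) ⨟ mk (wires 1) ⊠ ((mk triangle).transpose ⊠ mk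 (wires 1)) ⨟ mk cap ⊠ mk (wires 1) from by simp only [seq_assoc]))  -- assoc
  have s48 := s47.trans (cpr (_ : ZXClass 0 0) (show mk (wires 1) ⊠ mk (X 1 2 0) ⨟ mk (wires 1) ⊠ (mk triangle ⊠ mk (wires 1)) ⨟ mk (wires 2) ⊠ mk (Z 1 2 0) ⨟ mk (Z 2 1 0) ⊠ mk (wires 2) ⨟ mk (wires 1) ⊠ ((mk triangle).transpose ⊠ mk (wires 1)) ⨟ mk cap ⊠ mk (wires 1) = mk (wires 1) ⊠ mk (X 1 2 0) ⨟ mk (wires 1) ⊠ (mk triangle ⊠ mk (wires 1)) ⨟ mk (wires 2) ⊠ mk (Z 1 2 0) ⨟ mk (Z 2 1 0) ⊠ mk (wires 2) ⨟ (mk (wires 1) ⊠ ((mk triangle).transpose ⊠ mk (wires 1)) ⨟ mk cap ⊠ mk (wires 1)) from by simp only [seq_assoc]))  -- assoc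
  have s49 := s48.trans (cpr (_ : ZXClass 0 0) (cgr (_ : ZXClass 2 3) (cgl (show mk (wires 1) ⊠ ((mk triangle).transpose ⊠ mk (wires 1)) = mk (wires 1) ⊠ (mk triangle).transpose ⊠ mk (wires 1) from (par_assoc' _ _ _).trans (cast_id _ _ _)) (_ : ZXClass 3 1))))  -- par_assoc
  have s50 := s49.trans (cpr (_ : ZXClass 0 0) (cgr (_ : ZXClass 2 3) (show mk (wires 1) ⊠ (mk triangle).transpose ⊠ mk (wires 1) ⨟ mk cap ⊠ mk (wires 1) = (mk (wires 1) ⊠ (mk triangle).transpose ⨟ mk cap) ⊠ mk (wires 1) from (seq_par_wires _ _ 1).symm)))  -- seq_par_wires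
  have s51 := s50.trans (cpr (_ : ZXClass 0 0) (cgr (_ : ZXClass 2 3) (cpl (show mk (wires 1) ⊠ (mk triangle).transpose ⨟ mk cap = mk triangle ⊠ mk (wires 1) ⨟ mk cap from par_Tt_seq_cap) (_ : ZXClass 1 1))))  -- cap_par_Tt
  have s52 := s51.trans (cpr (_ : ZXClass 0 0) (cgr (_ : ZXClass 2 3) (show (mk triangle ⊠ mk (wires 1) ⨟ mk cap) ⊠ mk (wires 1) = mk triangle ⊠ mk (wires 1) ⊠ mk (wires 1) ⨟ mk cap ⊠ mk (wires 1) from by simp only [seq_par_wires])))  -- seq_par_wires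
  have s53 := s52.trans (cpr (_ : ZXClass 0 0) (show mk (wires 1) ⊠ mk (X 1 2 0) ⨟ mk (wires 1) ⊠ (mk triangle ⊠ mk (wires 1)) ⨟ mk (wires 2) ⊠ mk (Z 1 2 0) ⨟ mk (Z 2 1 0) ⊠ mk (wires 2) ⨟ (mk triangle ⊠ mk (wires 1) ⊠ mk (wires 1) ⨟ mk cap ⊠ mk (wires 1)) = mk (wires 1) ⊠ mk (X 1 2 0) ⨟ mk (wires 1) ⊠ (mk triangle ⊠ mk (wires 1)) ⨟ mk (wires 2) ⊠ mk (Z 1 2 0) ⨟ mk (Z 2 1 0) ⊠ mk (wires 2) ⨟ mk triangle ⊠ mk (wires 1) ⊠ mk (wires 1) ⨟ mk cap ⊠ mk (wires 1) from by simp only [seq_assoc]))  -- assoc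
  have s54 := s53.trans (cpr (_ : ZXClass 0 0) (cgl (cgr (_ : ZXClass 2 3) (show mk triangle ⊠ mk (wires 1) ⊠ mk (wires 1) = mk triangle ⊠ (mk (wires 1) ⊠ mk (wires 1)) from (par_assoc _ _ _).trans (cast_id _ _ _))) (_ : ZXClass 3 1)))  -- par_assoc
  have s55 := s54.trans (cpr (_ : ZXClass 0 0) (cgl (cgr (_ : ZXClass 2 3) (cpr (_ : ZXClass 1 1) (show mk (wires 1) ⊠ mk (wires 1) = mk (wires 2) from wires_par_wires 1 1))) (_ : ZXClass 3 1)))  -- wires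
  have s56 := s55.trans (cpr (_ : ZXClass 0 0) (cgl (cgl (show mk (wires 1) ⊠ mk (X 1 2 0) ⨟ mk (wires 1) ⊠ (mk triangle ⊠ mk (wires 1)) ⨟ mk (wires 2) ⊠ mk (Z 1 2 0) ⨟ mk (Z 2 1 0) ⊠ mk (wires 2) = mk (wires 1) ⊠ mk (X 1 2 0) ⨟ mk (wires 1) ⊠ (mk triangle ⊠ mk (wires 1)) ⨟ (mk (wires 2) ⊠ mk (Z 1 2 0) ⨟ mk (Z 2 1 0) ⊠ mk (wires 2)) from by simp only [seq_assoc]) (_ : ZXClass 3 3)) (_ : ZXClass 3 1)))  -- assoc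
  have s57 := s56.trans (cpr (_ : ZXClass 0 0) (cgl (cgl (cgr (_ : ZXClass 2 3) (show mk (wires 2) ⊠ mk (Z 1 2 0) ⨟ mk (Z 2 1 0) ⊠ mk (wires 2) = mk (Z 2 1 0) ⊠ mk (wires 1) ⨟ mk (wires 1) ⊠ mk (Z 1 2 0) from (slide _ _).symm)) (_ : ZXClass 3 3)) (_ : ZXClass 3 1)))  -- slide
  have s58 := s57.trans (cpr (_ : ZXClass 0 0) (show mk (wires 1) ⊠ mk (X 1 2 0) ⨟ mk (wires 1) ⊠ (mk triangle ⊠ mk (wires 1)) ⨟ (mk (Z 2 1 0) ⊠ mk (wires 1) ⨟ mk (wires 1) ⊠ mk (Z 1 2 0)) ⨟ mk triangle ⊠ mk (wires 2) ⨟ mk cap ⊠ mk (wires 1) = mk (wires 1) ⊠ mk (X 1 2 0) ⨟ mk (wires 1) ⊠ (mk triangle ⊠ mk (wires 1)) ⨟ mk (Z 2 1 0) ⊠ mk (wires 1) ⨟ mk (wires 1) ⊠ mk (Z 1 2 0) ⨟ mk triangle ⊠ mk (wires 2) ⨟ mk cap ⊠ mk (wires 1) from by simp only [seq_assoc]))  --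 assoc
  have s59 := s58.trans (cpr (_ : ZXClass 0 0) (cgl (show mk (wires 1) ⊠ mk (X 1 2 0) ⨟ mk (wires 1) ⊠ (mk triangle ⊠ mk (wires 1)) ⨟ mk (Z 2 1 0) ⊠ mk (wires 1) ⨟ mk (wires 1) ⊠ mk (Z 1 2 0) ⨟ mk triangle ⊠ mk (wires 2) = mk (wires 1) ⊠ mk (X 1 2 0) ⨟ mk (wires 1) ⊠ (mk triangle ⊠ mk (wires 1)) ⨟ mk (Z 2 1 0) ⊠ mk (wires 1) ⨟ (mk (wires 1) ⊠ mk (Z 1 2 0) ⨟ mk triangle ⊠ mk (wires 2)) from by simp only [seq_assoc]) (_ : ZXClass 3 1)))  -- assoc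
  have s60 := s59.trans (cpr (_ : ZXClass 0 0) (cgl (cgr (_ : ZXClass 2 2) (show mk (wires 1) ⊠ mk (Z 1 2 0) ⨟ mk triangle ⊠ mk (wires 2) = mk triangle ⊠ mk (wires 1) ⨟ mk (wires 1) ⊠ mk (Z 1 2 0) from (slide _ _).symm)) (_ : ZXClass 3 1)))  -- slide
  have s61 := s60.trans (cpr (_ : ZXClass 0 0) (show mk (wires 1) ⊠ mk (X 1 2 0) ⨟ mk (wires 1) ⊠ (mk triangle ⊠ mk (wires 1)) ⨟ mk (Z 2 1 0) ⊠ mk (wires 1) ⨟ (mk triangle ⊠ mk (wires 1) ⨟ mk (wires 1) ⊠ mk (Z 1 2 0)) ⨟ mk cap ⊠ mk (wires 1) = mk (wires 1) ⊠ mk (X 1 2 0) ⨟ mk (wires 1) ⊠ (mk triangle ⊠ mk (wires 1)) ⨟ mk (Z 2 1 0) ⊠ mk (wires 1) ⨟ mk triangle ⊠ mk (wires 1) ⨟ mk (wires 1) ⊠ mk (Z 1 2 0) ⨟ mk cap ⊠ mk (wires 1) from by simp only [seq_assoc]))  -- assoc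
  have s62 := s61.trans (cpr (_ : ZXClass 0 0) (show mk (wires 1) ⊠ mk (X 1 2 0) ⨟ mk (wires 1) ⊠ (mk triangle ⊠ mk (wires 1)) ⨟ mk (Z 2 1 0) ⊠ mk (wires 1) ⨟ mk triangle ⊠ mk (wires 1) ⨟ mk (wires 1) ⊠ mk (Z 1 2 0) ⨟ mk cap ⊠ mk (wires 1) = mk (wires 1) ⊠ mk (X 1 2 0) ⨟ mk (wires 1) ⊠ (mk triangle ⊠ mk (wires 1)) ⨟ mk (Z 2 1 0) ⊠ mk (wires 1) ⨟ mk triangle ⊠ mk (wires 1) ⨟ (mk (wires 1) ⊠ mk (Z 1 2 0) ⨟ mk cap ⊠ mk (wires 1)) from by simp only [seq_assoc]))  -- assoc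
  have s63 := s62.trans (cpr (_ : ZXClass 0 0) (cgr (_ : ZXClass 2 2) (show mk (wires 1) ⊠ mk (Z 1 2 0) ⨟ mk cap ⊠ mk (wires 1) = mk (Z 2 1 0) from (par_split_seq_cap_par 0))))  -- par_split_seq_cap_par
  have s64 := s63.trans ((show mk (dumbbell 0 0) ⊠ (mk (wires 1) ⊠ mk (X 1 2 0) ⨟ mk (wires 1) ⊠ (mk triangle ⊠ mk (wires 1)) ⨟ mk (Z 2 1 0) ⊠ mk (wires 1) ⨟ mk triangle ⊠ mk (wires 1) ⨟ mk (Z 2 1 0)) = mk switch from (mk_switch).symm))  -- mk_switch⁻¹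
  exact s64

/-- Re-laying out the left-hand side of `swapped-CNOT-under-controlsep` without the crossing (the red copy's outputs exchanged). [cite: JeandelPerdrixVilmart2018, §2.2 (spiders are symmetric)] -/
theorem swappedCNOT_lhs_relayout : mk (dumbbell 0 0) ⊠ (mk (X 1 2 0) ⊠ mk (wires 1) ⨟ mk (wires 1) ⊠ mk swap ⨟ mk (dumbbell 0 0) ⊠ (mk (X 1 2 0) ⊠ mk (wires 1) ⨟ mk triangle ⊠ (mk (Z 2 1 0) ⨟ (mk triangle).transpose) ⨟ mk (Z 2 1 0)) ⊠ mk (wires 1) ⨟ mk (Z 2 1 0)) = mk (dumbbell 0 0) ⊠ (mk (X 1 2 0) ⊠ mk (wires 1) ⨟ mk (wires 1) ⊠ (mk (dumbbell 0 0) ⊠ (mk (X 1 2 0) ⊠ mk (wires 1) ⨟ mk triangle ⊠ (mk (Z 2 1 0) ⨟ (mk triangle).transpose) ⨟ mk (Z 2 1 0))) ⨟ mk (Z 2 1 0)) := by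
  have s0 : mk (dumbbell 0 0) ⊠ (mk (X 1 2 0) ⊠ mk (wires 1) ⨟ mk (wires 1) ⊠ mk swap ⨟ mk (dumbbell 0 0) ⊠ (mk (X 1 2 0) ⊠ mk (wires 1) ⨟ mk triangle ⊠ (mk (Z 2 1 0) ⨟ (mk triangle).transpose) ⨟ mk (Z 2 1 0)) ⊠ mk (wires 1) ⨟ mk (Z 2 1 0)) = _ := cpr (_ : ZXClass 0 0) (cgl (cgl (cgl (cpl (show mk (X 1 2 0) = mk (X 1 2 0) ⨟ mk swap from ((X_seq_swap 1 0)).symm) (_ : ZXClass 1 1)) (_ : ZXClass 3 3)) (_ : ZXClass 3 2)) (_ : ZXClass 2 1))  -- X12_seq_swap⁻¹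
  have s1 := s0.trans (cpr (_ : ZXClass 0 0) (cgl (cgl (cgl (show (mk (X 1 2 0) ⨟ mk swap) ⊠ mk (wires 1) = mk (X 1 2 0) ⊠ mk (wires 1) ⨟ mk swap ⊠ mk (wires 1) from by simp only [seq_par_wires]) (_ : ZXClass 3 3)) (_ : ZXClass 3 2)) (_ : ZXClass 2 1)))  -- seq_par_wires
  have s2 := s1.trans (cpr (_ : ZXClass 0 0) (cgl (cgl (show mk (X 1 2 0) ⊠ mk (wires 1) ⨟ mk swap ⊠ mk (wires 1) ⨟ mk (wires 1) ⊠ mk swap = mk (X 1 2 0) ⊠ mk (wires 1) ⨟ (mk swap ⊠ mk (wires 1) ⨟ mk (wires 1) ⊠ mk swap) from by simp only [seq_assoc]) (_ : ZXClass 3 2)) (_ : ZXClass 2 1)))  -- assoc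
  have s3 := s2.trans (cpr (_ : ZXClass 0 0) (cgl (cgl (cgr (_ : ZXClass 2 3) (show mk swap ⊠ mk (wires 1) ⨟ mk (wires 1) ⊠ mk swap = mk (fswap1 2) from (fswap1_two).symm)) (_ : ZXClass 3 2)) (_ : ZXClass 2 1)))  -- fswap1_two⁻¹
  have s4 := s3.trans (cpr (_ : ZXClass 0 0) (cgl (show mk (X 1 2 0) ⊠ mk (wires 1) ⨟ mk (fswap1 2) ⨟ mk (dumbbell 0 0) ⊠ (mk (X 1 2 0) ⊠ mk (wires 1) ⨟ mk triangle ⊠ (mk (Z 2 1 0) ⨟ (mk triangle).transpose) ⨟ mk (Z 2 1 0)) ⊠ mk (wires 1) = mk (X 1 2 0) ⊠ mk (wires 1) ⨟ (mk (fswap1 2) ⨟ mk (dumbbell 0 0) ⊠ (mk (X 1 2 0) ⊠ mk (wires 1) ⨟ mk triangle ⊠ (mk (Z 2 1 0) ⨟ (mk triangle).transpose) ⨟ mk (Z 2 1 0)) ⊠ mk (wires 1)) from by simp only [seq_assoc]) (_ : ZXClass 2 1)))  -- assoc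
  have s5 := s4.trans (cpr (_ : ZXClass 0 0) (cgl (cgr (_ : ZXClass 2 3) (show mk (fswap1 2) ⨟ mk (dumbbell 0 0) ⊠ (mk (X 1 2 0) ⊠ mk (wires 1) ⨟ mk triangle ⊠ (mk (Z 2 1 0) ⨟ (mk triangle).transpose) ⨟ mk (Z 2 1 0)) ⊠ mk (wires 1) = mk (wires 1) ⊠ (mk (dumbbell 0 0) ⊠ (mk (X 1 2 0) ⊠ mk (wires 1) ⨟ mk triangle ⊠ (mk (Z 2 1 0) ⨟ (mk triangle).transpose) ⨟ mk (Z 2 1 0))) ⨟ mk (fswap1 1) from (fswap1_nat (mk (dumbbell 0 0) ⊠ (mk (X 1 2 0) ⊠ mk (wires 1) ⨟ mk triangle ⊠ (mk (Z 2 1 0) ⨟ (mk triangle).transpose) ⨟ mk (Z 2 1 0)))))) (_ : ZXClass 2 1)))  -- fswap1_nat_core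
  have s6 := s5.trans (cpr (_ : ZXClass 0 0) (show mk (X 1 2 0) ⊠ mk (wires 1) ⨟ (mk (wires 1) ⊠ (mk (dumbbell 0 0) ⊠ (mk (X 1 2 0) ⊠ mk (wires 1) ⨟ mk triangle ⊠ (mk (Z 2 1 0) ⨟ (mk triangle).transpose) ⨟ mk (Z 2 1 0))) ⨟ mk (fswap1 1)) ⨟ mk (Z 2 1 0) = mk (X 1 2 0) ⊠ mk (wires 1) ⨟ mk (wires 1) ⊠ (mk (dumbbell 0 0) ⊠ (mk (X 1 2 0) ⊠ mk (wires 1) ⨟ mk triangle ⊠ (mk (Z 2 1 0) ⨟ (mk triangle).transpose) ⨟ mk (Z 2 1 0))) ⨟ mk (fswap1 1) ⨟ mk (Z 2 1 0) from by simp only [seq_assoc]))  -- assoc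
  have s7 := s6.trans (cpr (_ : ZXClass 0 0) (cgl (cgr (_ : ZXClass 2 2) (show mk (fswap1 1) = mk swap from fswap1_one)) (_ : ZXClass 2 1)))  -- fswap1_one
  have s8 := s7.trans (cpr (_ : ZXClass 0 0) (show mk (X 1 2 0) ⊠ mk (wires 1) ⨟ mk (wires 1) ⊠ (mk (dumbbell 0 0) ⊠ (mk (X 1 2 0) ⊠ mk (wires 1) ⨟ mk triangle ⊠ (mk (Z 2 1 0) ⨟ (mk triangle).transpose) ⨟ mk (Z 2 1 0))) ⨟ mk swap ⨟ mk (Z 2 1 0) = mk (X 1 2 0) ⊠ mk (wires 1) ⨟ mk (wires 1) ⊠ (mk (dumbbell 0 0) ⊠ (mk (X 1 2 0) ⊠ mk (wires 1) ⨟ mk triangle ⊠ (mk (Z 2 1 0) ⨟ (mk triangle).transpose) ⨟ mk (Z 2 1 0))) ⨟ (mk swap ⨟ mk (Z 2 1 0)) from by simp only [seq_assoc]))  -- assoc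
  have s9 := s8.trans (cpr (_ : ZXClass 0 0) (cgr (_ : ZXClass 2 2) (show mk swap ⨟ mk (Z 2 1 0) = mk (Z 2 1 0) from (swap_seq_Z 1 0))))  -- swap_seq_Z21
  exact s9

/-- The bent left-hand side of `swapped-CNOT-under-controlsep` is the switch with its target green-copied and one copy red-merged into the control. [cite: JeandelPerdrixVilmart2019, Appendix B, Lemma `swapped-CNOT-under-controlsep`; JeandelPerdrixVilmart2018, §2.2] -/
theorem flat_swappedCNOT_lhs : mk (wires 2) ⊠ mk cup ⨟ mk (wires 1) ⊠ (mk (dumbbell 0 0) ⊠ (mk (X 1 2 0) ⊠ mk (wires 1) ⨟ mk (wires 1) ⊠ (mk (dumbbell 0 0) ⊠ (mk (X 1 2 0) ⊠ mk (wires 1) ⨟ mk triangle ⊠ (mk (Z 2 1 0) ⨟ (mk triangle).transpose) ⨟ mk (Z 2 1 0))) ⨟ mk (Z 2 1 0))) ⊠ mk (wires 1) ⨟ mk cap ⊠ mk (wires 1) = mk (Z 1 2 0) ⊠ mk (wires 1) ⨟ mk (wires 1) ⊠ (mk (dumbbell 0 0) ⊠ mk (X 2 1 0)) ⨟ mk switch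 := by
  have s0 : mk (wires 2) ⊠ mk cup ⨟ mk (wires 1) ⊠ (mk (dumbbell 0 0) ⊠ (mk (X 1 2 0) ⊠ mk (wires 1) ⨟ mk (wires 1) ⊠ (mk (dumbbell 0 0) ⊠ (mk (X 1 2 0) ⊠ mk (wires 1) ⨟ mk triangle ⊠ (mk (Z 2 1 0) ⨟ (mk triangle).transpose) ⨟ mk (Z 2 1 0))) ⨟ mk (Z 2 1 0))) ⊠ mk (wires 1) ⨟ mk cap ⊠ mk (wires 1) = _ := cgl (cgr (_ : ZXClass 2 4) (cpl (show mk (wires 1) ⊠ (mk (dumbbell 0 0) ⊠ (mk (X 1 2 0) ⊠ mk (wires 1) ⨟ mk (wires 1) ⊠ (mk (dumbbell 0 0) ⊠ (mk (X 1 2 0) ⊠ mk (wires 1) ⨟ mk triangle ⊠ (mk (Z 2 1 0) ⨟ (mk triangle).transpose) ⨟ mk (Z 2 1 0))) ⨟ mk (Z 2 1 0))) = mk (dumbbell 0 0) ⊠ (mk (wires 1) ⊠ (mk (X 1 2 0) ⊠ mk (wires 1) ⨟ mk (wires 1) ⊠ (mk (dumbbell 0 0) ⊠ (mk (X 1 2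 0) ⊠ mk (wires 1) ⨟ mk triangle ⊠ (mk (Z 2 1 0) ⨟ (mk triangle).transpose) ⨟ mk (Z 2 1 0))) ⨟ mk (Z 2 1 0))) from ((par_assoc' _ _ _).trans (cast_id _ _ _)).trans ((cpl (scalar_par_wires _).symm _).trans ((par_assoc _ _ _).trans (cast_id _ _ _)))) (_ : ZXClass 1 1))) (_ : ZXClass 3 1)  -- scalar
  have s1 := s0.trans (cgl (cgr (_ : ZXClass 2 4) (show mk (dumbbell 0 0) ⊠ (mk (wires 1) ⊠ (mk (X 1 2 0) ⊠ mk (wires 1) ⨟ mk (wires 1) ⊠ (mk (dumbbell 0 0) ⊠ (mk (X 1 2 0) ⊠ mk (wires 1) ⨟ mk triangle ⊠ (mk (Z 2 1 0) ⨟ (mk triangle).transpose) ⨟ mk (Z 2 1 0))) ⨟ mk (Z 2 1 0))) ⊠ mk (wires 1) = mk (dumbbell 0 0) ⊠ (mk (wires 1) ⊠ (mk (X 1 2 0) ⊠ mk (wires 1) ⨟ mk (wires 1) ⊠ (mk (dumbbell 0 0) ⊠ (mk (X 1 2 0) ⊠ mk (wires 1) ⨟ mk triangle ⊠ (mk (Z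 2 1 0) ⨟ (mk triangle).transpose) ⨟ mk (Z 2 1 0))) ⨟ mk (Z 2 1 0)) ⊠ mk (wires 1)) from (par_assoc _ _ _).trans (cast_id _ _ _))) (_ : ZXClass 3 1))  -- scalar
  have s2 := s1.trans (cgl (show mk (wires 2) ⊠ mk cup ⨟ mk (dumbbell 0 0) ⊠ (mk (wires 1) ⊠ (mk (X 1 2 0) ⊠ mk (wires 1) ⨟ mk (wires 1) ⊠ (mk (dumbbell 0 0) ⊠ (mk (X 1 2 0) ⊠ mk (wires 1) ⨟ mk triangle ⊠ (mk (Z 2 1 0) ⨟ (mk triangle).transpose) ⨟ mk (Z 2 1 0))) ⨟ mk (Z 2 1 0)) ⊠ mk (wires 1)) = mk (dumbbell 0 0) ⊠ (mk (wires 2) ⊠ mk cup ⨟ mk (wires 1) ⊠ (mk (X 1 2 0) ⊠ mk (wires 1) ⨟ mk (wires 1) ⊠ (mk (dumbbell 0 0) ⊠ (mk (X 1 2 0) ⊠ mk (wires 1) ⨟ mk triangle ⊠ (mk (Z 2 1 0) ⨟ (mk triangle).transpose) ⨟ mk (Z 2 1 0))) ⨟ mk (Z 2 1 0)) ⊠ mk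 (wires 1)) from by rw [scalar_par_seq_right (mk (dumbbell 0 0)) (mk (wires 2) ⊠ mk cup) (mk (wires 1) ⊠ (mk (X 1 2 0) ⊠ mk (wires 1) ⨟ mk (wires 1) ⊠ (mk (dumbbell 0 0) ⊠ (mk (X 1 2 0) ⊠ mk (wires 1) ⨟ mk triangle ⊠ (mk (Z 2 1 0) ⨟ (mk triangle).transpose) ⨟ mk (Z 2 1 0))) ⨟ mk (Z 2 1 0)) ⊠ mk (wires 1)), empty_par, cast_id]) (_ : ZXClass 3 1))  -- scalar
  have s3 := s2.trans ((show mk (dumbbell 0 0) ⊠ (mk (wires 2) ⊠ mk cup ⨟ mk (wires 1) ⊠ (mk (X 1 2 0) ⊠ mk (wires 1) ⨟ mk (wires 1) ⊠ (mk (dumbbell 0 0) ⊠ (mk (X 1 2 0) ⊠ mk (wires 1) ⨟ mk triangle ⊠ (mk (Z 2 1 0) ⨟ (mk triangle).transpose) ⨟ mk (Z 2 1 0))) ⨟ mk (Z 2 1 0)) ⊠ mk (wires 1)) ⨟ mk cap ⊠ mk (wires 1) = mk (dumbbell 0 0) ⊠ (mk (wires 2) ⊠ mk cup ⨟ mk (wires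 1) ⊠ (mk (X 1 2 0) ⊠ mk (wires 1) ⨟ mk (wires 1) ⊠ (mk (dumbbell 0 0) ⊠ (mk (X 1 2 0) ⊠ mk (wires 1) ⨟ mk triangle ⊠ (mk (Z 2 1 0) ⨟ (mk triangle).transpose) ⨟ mk (Z 2 1 0))) ⨟ mk (Z 2 1 0)) ⊠ mk (wires 1) ⨟ mk cap ⊠ mk (wires 1)) from by rw [scalar_par_seq_left (mk (dumbbell 0 0)) (mk (wires 2) ⊠ mk cup ⨟ mk (wires 1) ⊠ (mk (X 1 2 0) ⊠ mk (wires 1) ⨟ mk (wires 1) ⊠ (mk (dumbbell 0 0) ⊠ (mk (X 1 2 0) ⊠ mk (wires 1) ⨟ mk triangle ⊠ (mk (Z 2 1 0) ⨟ (mk triangle).transpose) ⨟ mk (Z 2 1 0))) ⨟ mk (Z 2 1 0)) ⊠ mk (wires 1)) (mk cap ⊠ mk (wires 1)), empty_par, cast_id]))  -- scalar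
  have s4 := s3.trans (cpr (_ : ZXClass 0 0) (cgl (cgr (_ : ZXClass 2 4) (cpl (show mk (wires 1) ⊠ (mk (X 1 2 0) ⊠ mk (wires 1) ⨟ mk (wires 1) ⊠ (mk (dumbbell 0 0) ⊠ (mk (X 1 2 0) ⊠ mk (wires 1) ⨟ mk triangle ⊠ (mk (Z 2 1 0) ⨟ (mk triangle).transpose) ⨟ mk (Z 2 1 0))) ⨟ mk (Z 2 1 0)) = mk (wires 1) ⊠ (mk (X 1 2 0) ⊠ mk (wires 1)) ⨟ mk (wires 1) ⊠ (mk (wires 1) ⊠ (mk (dumbbell 0 0) ⊠ (mk (X 1 2 0) ⊠ mk (wires 1) ⨟ mk triangle ⊠ (mk (Z 2 1 0) ⨟ (mk triangle).transpose) ⨟ mk (Z 2 1 0)))) ⨟ mk (wires 1) ⊠ mk (Z 2 1 0) from by simp only [wires_par_seq]) (_ : ZXClass 1 1))) (_ : ZXClass 3 1)))  -- wires_par_seq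
  have s5 := s4.trans (cpr (_ : ZXClass 0 0) (cgl (cgr (_ : ZXClass 2 4) (show (mk (wires 1) ⊠ (mk (X 1 2 0) ⊠ mk (wires 1)) ⨟ mk (wires 1) ⊠ (mk (wires 1) ⊠ (mk (dumbbell 0 0) ⊠ (mk (X 1 2 0) ⊠ mk (wires 1) ⨟ mk triangle ⊠ (mk (Z 2 1 0) ⨟ (mk triangle).transpose) ⨟ mk (Z 2 1 0)))) ⨟ mk (wires 1) ⊠ mk (Z 2 1 0)) ⊠ mk (wires 1) = mk (wires 1) ⊠ (mk (X 1 2 0) ⊠ mk (wires 1)) ⊠ mk (wires 1) ⨟ mk (wires 1) ⊠ (mk (wires 1) ⊠ (mk (dumbbell 0 0) ⊠ (mk (X 1 2 0) ⊠ mk (wires 1) ⨟ mk triangle ⊠ (mk (Z 2 1 0) ⨟ (mk triangle).transpose) ⨟ mk (Z 2 1 0)))) ⊠ mk (wires 1) ⨟ mk (wires 1) ⊠ mk (Z 2 1 0) ⊠ mk (wires 1) from by simp only [seq_par_wires])) (_ : ZXClass 3 1)))  -- seq_par_wires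
  have s6 := s5.trans (cpr (_ : ZXClass 0 0) (show mk (wires 2) ⊠ mk cup ⨟ (mk (wires 1) ⊠ (mk (X 1 2 0) ⊠ mk (wires 1)) ⊠ mk (wires 1) ⨟ mk (wires 1) ⊠ (mk (wires 1) ⊠ (mk (dumbbell 0 0) ⊠ (mk (X 1 2 0) ⊠ mk (wires 1) ⨟ mk triangle ⊠ (mk (Z 2 1 0) ⨟ (mk triangle).transpose) ⨟ mk (Z 2 1 0)))) ⊠ mk (wires 1) ⨟ mk (wires 1) ⊠ mk (Z 2 1 0) ⊠ mk (wires 1)) ⨟ mk cap ⊠ mk (wires 1) = mk (wires 2) ⊠ mk cup ⨟ mk (wires 1) ⊠ (mk (X 1 2 0) ⊠ mk (wires 1)) ⊠ mk (wires 1) ⨟ mk (wires 1) ⊠ (mk (wires 1) ⊠ (mk (dumbbell 0 0) ⊠ (mk (X 1 2 0) ⊠ mk (wires 1) ⨟ mk triangle ⊠ (mk (Z 2 1 0) ⨟ (mk triangle).transpose) ⨟ mk (Z 2 1 0)))) ⊠ mk (wires 1) ⨟ mk (wires 1) ⊠ mk (Z 2 1 0) ⊠ mk (wires 1) ⨟ mk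 cap ⊠ mk (wires 1) from by simp only [seq_assoc]))  -- assoc
  have s7 := s6.trans (cpr (_ : ZXClass 0 0) (cgl (cgl (cgr (_ : ZXClass 2 5) (cpl (cpr (_ : ZXClass 1 1) (show mk (wires 1) ⊠ (mk (dumbbell 0 0) ⊠ (mk (X 1 2 0) ⊠ mk (wires 1) ⨟ mk triangle ⊠ (mk (Z 2 1 0) ⨟ (mk triangle).transpose) ⨟ mk (Z 2 1 0))) = mk (dumbbell 0 0) ⊠ (mk (wires 1) ⊠ (mk (X 1 2 0) ⊠ mk (wires 1) ⨟ mk triangle ⊠ (mk (Z 2 1 0) ⨟ (mk triangle).transpose) ⨟ mk (Z 2 1 0))) from ((par_assoc' _ _ _).trans (cast_id _ _ _)).trans ((cpl (scalar_par_wires _).symm _).trans ((par_assoc _ _ _).trans (cast_id _ _ _))))) (_ : ZXClass 1 1))) (_ : ZXClass 4 3)) (_ : ZXClass 3 1)))  -- scalar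
  have s8 := s7.trans (cpr (_ : ZXClass 0 0) (cgl (cgl (cgr (_ : ZXClass 2 5) (cpl (show mk (wires 1) ⊠ (mk (dumbbell 0 0) ⊠ (mk (wires 1) ⊠ (mk (X 1 2 0) ⊠ mk (wires 1) ⨟ mk triangle ⊠ (mk (Z 2 1 0) ⨟ (mk triangle).transpose) ⨟ mk (Z 2 1 0)))) = mk (dumbbell 0 0) ⊠ (mk (wires 1) ⊠ (mk (wires 1) ⊠ (mk (X 1 2 0) ⊠ mk (wires 1) ⨟ mk triangle ⊠ (mk (Z 2 1 0) ⨟ (mk triangle).transpose) ⨟ mk (Z 2 1 0)))) from ((par_assoc' _ _ _).trans (cast_id _ _ _)).trans ((cpl (scalar_par_wires _).symm _).trans ((par_assoc _ _ _).trans (cast_id _ _ _)))) (_ : ZXClass 1 1))) (_ : ZXClass 4 3)) (_ : ZXClass 3 1)))  -- scalar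
  have s9 := s8.trans (cpr (_ : ZXClass 0 0) (cgl (cgl (cgr (_ : ZXClass 2 5) (show mk (dumbbell 0 0) ⊠ (mk (wires 1) ⊠ (mk (wires 1) ⊠ (mk (X 1 2 0) ⊠ mk (wires 1) ⨟ mk triangle ⊠ (mk (Z 2 1 0) ⨟ (mk triangle).transpose) ⨟ mk (Z 2 1 0)))) ⊠ mk (wires 1) = mk (dumbbell 0 0) ⊠ (mk (wires 1) ⊠ (mk (wires 1) ⊠ (mk (X 1 2 0) ⊠ mk (wires 1) ⨟ mk triangle ⊠ (mk (Z 2 1 0) ⨟ (mk triangle).transpose) ⨟ mk (Z 2 1 0))) ⊠ mk (wires 1)) from (par_assoc _ _ _).trans (cast_id _ _ _))) (_ : ZXClass 4 3)) (_ : ZXClass 3 1)))  -- scalar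
  have s10 := s9.trans (cpr (_ : ZXClass 0 0) (cgl (cgl (show mk (wires 2) ⊠ mk cup ⨟ mk (wires 1) ⊠ (mk (X 1 2 0) ⊠ mk (wires 1)) ⊠ mk (wires 1) ⨟ mk (dumbbell 0 0) ⊠ (mk (wires 1) ⊠ (mk (wires 1) ⊠ (mk (X 1 2 0) ⊠ mk (wires 1) ⨟ mk triangle ⊠ (mk (Z 2 1 0) ⨟ (mk triangle).transpose) ⨟ mk (Z 2 1 0))) ⊠ mk (wires 1)) = mk (dumbbell 0 0) ⊠ (mk (wires 2) ⊠ mk cup ⨟ mk (wires 1) ⊠ (mk (X 1 2 0) ⊠ mk (wires 1)) ⊠ mk (wires 1) ⨟ mk (wires 1) ⊠ (mk (wires 1) ⊠ (mk (X 1 2 0) ⊠ mk (wires 1) ⨟ mk triangle ⊠ (mk (Z 2 1 0) ⨟ (mk triangle).transpose) ⨟ mk (Z 2 1 0))) ⊠ mk (wires 1)) from by rw [scalar_par_seq_right (mk (dumbbell 0 0)) (mk (wires 2) ⊠ mk cup ⨟ mk (wires 1) ⊠ (mk (X 1 2 0) ⊠ mk (wires 1)) ⊠ mk (wires 1)) (mk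 (wires 1) ⊠ (mk (wires 1) ⊠ (mk (X 1 2 0) ⊠ mk (wires 1) ⨟ mk triangle ⊠ (mk (Z 2 1 0) ⨟ (mk triangle).transpose) ⨟ mk (Z 2 1 0))) ⊠ mk (wires 1)), empty_par, cast_id]) (_ : ZXClass 4 3)) (_ : ZXClass 3 1)))  -- scalar
  have s11 := s10.trans (cpr (_ : ZXClass 0 0) (cgl (show mk (dumbbell 0 0) ⊠ (mk (wires 2) ⊠ mk cup ⨟ mk (wires 1) ⊠ (mk (X 1 2 0) ⊠ mk (wires 1)) ⊠ mk (wires 1) ⨟ mk (wires 1) ⊠ (mk (wires 1) ⊠ (mk (X 1 2 0) ⊠ mk (wires 1) ⨟ mk triangle ⊠ (mk (Z 2 1 0) ⨟ (mk triangle).transpose) ⨟ mk (Z 2 1 0))) ⊠ mk (wires 1)) ⨟ mk (wires 1) ⊠ mk (Z 2 1 0) ⊠ mk (wires 1) = mk (dumbbell 0 0) ⊠ (mk (wires 2) ⊠ mk cup ⨟ mk (wires 1) ⊠ (mk (X 1 2 0) ⊠ mk (wires 1)) ⊠ mk (wires 1) ⨟ mk (wires 1) ⊠ (mk (wires 1)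 ⊠ (mk (X 1 2 0) ⊠ mk (wires 1) ⨟ mk triangle ⊠ (mk (Z 2 1 0) ⨟ (mk triangle).transpose) ⨟ mk (Z 2 1 0))) ⊠ mk (wires 1) ⨟ mk (wires 1) ⊠ mk (Z 2 1 0) ⊠ mk (wires 1)) from by rw [scalar_par_seq_left (mk (dumbbell 0 0)) (mk (wires 2) ⊠ mk cup ⨟ mk (wires 1) ⊠ (mk (X 1 2 0) ⊠ mk (wires 1)) ⊠ mk (wires 1) ⨟ mk (wires 1) ⊠ (mk (wires 1) ⊠ (mk (X 1 2 0) ⊠ mk (wires 1) ⨟ mk triangle ⊠ (mk (Z 2 1 0) ⨟ (mk triangle).transpose) ⨟ mk (Z 2 1 0))) ⊠ mk (wires 1)) (mk (wires 1) ⊠ mk (Z 2 1 0) ⊠ mk (wires 1)), empty_par, cast_id]) (_ : ZXClass 3 1)))  -- scalar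
  have s12 := s11.trans (cpr (_ : ZXClass 0 0) (show mk (dumbbell 0 0) ⊠ (mk (wires 2) ⊠ mk cup ⨟ mk (wires 1) ⊠ (mk (X 1 2 0) ⊠ mk (wires 1)) ⊠ mk (wires 1) ⨟ mk (wires 1) ⊠ (mk (wires 1) ⊠ (mk (X 1 2 0) ⊠ mk (wires 1) ⨟ mk triangle ⊠ (mk (Z 2 1 0) ⨟ (mk triangle).transpose) ⨟ mk (Z 2 1 0))) ⊠ mk (wires 1) ⨟ mk (wires 1) ⊠ mk (Z 2 1 0) ⊠ mk (wires 1)) ⨟ mk cap ⊠ mk (wires 1) = mk (dumbbell 0 0) ⊠ (mk (wires 2) ⊠ mk cup ⨟ mk (wires 1) ⊠ (mk (X 1 2 0) ⊠ mk (wires 1)) ⊠ mk (wires 1) ⨟ mk (wires 1) ⊠ (mk (wires 1) ⊠ (mk (X 1 2 0) ⊠ mk (wires 1) ⨟ mk triangle ⊠ (mk (Z 2 1 0) ⨟ (mk triangle).transpose) ⨟ mk (Z 2 1 0))) ⊠ mk (wires 1) ⨟ mk (wires 1) ⊠ mk (Z 2 1 0) ⊠ mk (wires 1) ⨟ mk cap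 ⊠ mk (wires 1)) from by rw [scalar_par_seq_left (mk (dumbbell 0 0)) (mk (wires 2) ⊠ mk cup ⨟ mk (wires 1) ⊠ (mk (X 1 2 0) ⊠ mk (wires 1)) ⊠ mk (wires 1) ⨟ mk (wires 1) ⊠ (mk (wires 1) ⊠ (mk (X 1 2 0) ⊠ mk (wires 1) ⨟ mk triangle ⊠ (mk (Z 2 1 0) ⨟ (mk triangle).transpose) ⨟ mk (Z 2 1 0))) ⊠ mk (wires 1) ⨟ mk (wires 1) ⊠ mk (Z 2 1 0) ⊠ mk (wires 1)) (mk cap ⊠ mk (wires 1)), empty_par, cast_id]))  -- scalar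
  have s13 := s12.trans (cpr (_ : ZXClass 0 0) (cpr (_ : ZXClass 0 0) (show mk (wires 2) ⊠ mk cup ⨟ mk (wires 1) ⊠ (mk (X 1 2 0) ⊠ mk (wires 1)) ⊠ mk (wires 1) ⨟ mk (wires 1) ⊠ (mk (wires 1) ⊠ (mk (X 1 2 0) ⊠ mk (wires 1) ⨟ mk triangle ⊠ (mk (Z 2 1 0) ⨟ (mk triangle).transpose) ⨟ mk (Z 2 1 0))) ⊠ mk (wires 1) ⨟ mk (wires 1) ⊠ mk (Z 2 1 0) ⊠ mk (wires 1) ⨟ mk cap ⊠ mk (wires 1) = mk (wires 2) ⊠ mk cup ⨟ mk (wires 1) ⊠ (mk (X 1 2 0) ⊠ mk (wires 1)) ⊠ mk (wires 1) ⨟ mk (wires 1) ⊠ (mk (wires 1) ⊠ (mk (X 1 2 0) ⊠ mk (wires 1) ⨟ mk triangle ⊠ (mk (Z 2 1 0) ⨟ (mk triangle).transpose) ⨟ mk (Z 2 1 0))) ⊠ mk (wires 1) ⨟ (mk (wires 1) ⊠ mk (Z 2 1 0) ⊠ mk (wires 1) ⨟ mk cap ⊠ mk (wires 1)) from by simp only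 [seq_assoc])))  -- assoc
  have s14 := s13.trans (cpr (_ : ZXClass 0 0) (cpr (_ : ZXClass 0 0) (cgr (_ : ZXClass 2 4) (show mk (wires 1) ⊠ mk (Z 2 1 0) ⊠ mk (wires 1) ⨟ mk cap ⊠ mk (wires 1) = (mk (wires 1) ⊠ mk (Z 2 1 0) ⨟ mk cap) ⊠ mk (wires 1) from (seq_par_wires _ _ 1).symm))))  -- seq_par_wires
  have s15 := s14.trans (cpr (_ : ZXClass 0 0) (cpr (_ : ZXClass 0 0) (cgr (_ : ZXClass 2 4) (cpl (cgr (_ : ZXClass 3 2) (show mk cap = mk (Z 2 0 0) from (Z_two_zero).symm)) (_ : ZXClass 1 1)))))  -- Z_two_zero⁻¹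
  have s16 := s15.trans (cpr (_ : ZXClass 0 0) (cpr (_ : ZXClass 0 0) (cgr (_ : ZXClass 2 4) (cpl (show mk (wires 1) ⊠ mk (Z 2 1 0) ⨟ mk (Z 2 0 0) = mk (Z 3 0 0) from (par_Z_seq_Z 1 2 1 0 le_rfl 0 0)) (_ : ZXClass 1 1)))))  -- par_Z21_seq_Z20
  have s17 := s16.trans (cpr (_ : ZXClass 0 0) (cpr (_ : ZXClass 0 0) (cgr (_ : ZXClass 2 4) (cpl (show mk (Z 3 0 0) = mk (Z 2 1 0) ⊠ mk (wires 1) ⨟ mk cap from (merge_par_seq_cap).symm) (_ : ZXClass 1 1)))))  -- Z21_par_seq_cap⁻¹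
  have s18 := s17.trans (cpr (_ : ZXClass 0 0) (cpr (_ : ZXClass 0 0) (cgr (_ : ZXClass 2 4) (cpl (cgl (cpl (show mk (Z 2 1 0) = mk (Z 1 2 0) ⊠ mk (wires 1) ⨟ mk (wires 1) ⊠ mk cap from (split_par_seq_par_cap).symm) (_ : ZXClass 1 1)) (_ : ZXClass 2 0)) (_ : ZXClass 1 1)))))  -- split_par_seq_par_cap⁻¹
  have s19 := s18.trans (cpr (_ : ZXClass 0 0) (cpr (_ : ZXClass 0 0) (cgr (_ : ZXClass 2 4) (cpl (cgl (show (mk (Z 1 2 0) ⊠ mk (wires 1) ⨟ mk (wires 1) ⊠ mk cap) ⊠ mk (wires 1) = mk (Z 1 2 0) ⊠ mk (wires 1) ⊠ mk (wires 1) ⨟ mk (wires 1) ⊠ mk cap ⊠ mk (wires 1) from by simp only [seq_par_wires]) (_ : ZXClass 2 0)) (_ : ZXClass 1 1)))))  -- seq_par_wires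
  have s20 := s19.trans (cpr (_ : ZXClass 0 0) (cpr (_ : ZXClass 0 0) (cgr (_ : ZXClass 2 4) (show (mk (Z 1 2 0) ⊠ mk (wires 1) ⊠ mk (wires 1) ⨟ mk (wires 1) ⊠ mk cap ⊠ mk (wires 1) ⨟ mk cap) ⊠ mk (wires 1) = mk (Z 1 2 0) ⊠ mk (wires 1) ⊠ mk (wires 1) ⊠ mk (wires 1) ⨟ mk (wires 1) ⊠ mk cap ⊠ mk (wires 1) ⊠ mk (wires 1) ⨟ mk cap ⊠ mk (wires 1) from by simp only [seq_par_wires]))))  -- seq_par_wires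
  have s21 := s20.trans (cpr (_ : ZXClass 0 0) (cpr (_ : ZXClass 0 0) (show mk (wires 2) ⊠ mk cup ⨟ mk (wires 1) ⊠ (mk (X 1 2 0) ⊠ mk (wires 1)) ⊠ mk (wires 1) ⨟ mk (wires 1) ⊠ (mk (wires 1) ⊠ (mk (X 1 2 0) ⊠ mk (wires 1) ⨟ mk triangle ⊠ (mk (Z 2 1 0) ⨟ (mk triangle).transpose) ⨟ mk (Z 2 1 0))) ⊠ mk (wires 1) ⨟ (mk (Z 1 2 0) ⊠ mk (wires 1) ⊠ mk (wires 1) ⊠ mk (wires 1) ⨟ mk (wires 1) ⊠ mk cap ⊠ mk (wires 1) ⊠ mk (wires 1) ⨟ mk cap ⊠ mk (wires 1)) = mk (wires 2) ⊠ mk cup ⨟ mk (wires 1) ⊠ (mk (X 1 2 0) ⊠ mk (wires 1)) ⊠ mk (wires 1) ⨟ mk (wires 1) ⊠ (mk (wires 1) ⊠ (mk (X 1 2 0) ⊠ mk (wires 1) ⨟ mk triangle ⊠ (mk (Z 2 1 0) ⨟ (mk triangle).transpose) ⨟ mk (Z 2 1 0))) ⊠ mk (wires 1) ⨟ mk (Z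 1 2 0) ⊠ mk (wires 1) ⊠ mk (wires 1) ⊠ mk (wires 1) ⨟ mk (wires 1) ⊠ mk cap ⊠ mk (wires 1) ⊠ mk (wires 1) ⨟ mk cap ⊠ mk (wires 1) from by simp only [seq_assoc])))  -- assoc
  have s22 := s21.trans (cpr (_ : ZXClass 0 0) (cpr (_ : ZXClass 0 0) (cgl (cgl (cgr (_ : ZXClass 2 4) (show mk (Z 1 2 0) ⊠ mk (wires 1) ⊠ mk (wires 1) ⊠ mk (wires 1) = mk (Z 1 2 0) ⊠ mk (wires 1) ⊠ (mk (wires 1) ⊠ mk (wires 1)) from (par_assoc _ _ _).trans (cast_id _ _ _))) (_ : ZXClass 5 3)) (_ : ZXClass 3 1))))  -- par_assoc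
  have s23 := s22.trans (cpr (_ : ZXClass 0 0) (cpr (_ : ZXClass 0 0) (cgl (cgl (cgr (_ : ZXClass 2 4) (cpr (_ : ZXClass 2 3) (show mk (wires 1) ⊠ mk (wires 1) = mk (wires 2) from wires_par_wires 1 1))) (_ : ZXClass 5 3)) (_ : ZXClass 3 1))))  -- wires
  have s24 := s23.trans (cpr (_ : ZXClass 0 0) (cpr (_ : ZXClass 0 0) (cgl (cgl (cgr (_ : ZXClass 2 4) (show mk (Z 1 2 0) ⊠ mk (wires 1) ⊠ mk (wires 2) = mk (Z 1 2 0) ⊠ (mk (wires 1) ⊠ mk (wires 2)) from (par_assoc _ _ _).trans (cast_id _ _ _))) (_ : ZXClass 5 3)) (_ : ZXClass 3 1))))  -- par_assoc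
  have s25 := s24.trans (cpr (_ : ZXClass 0 0) (cpr (_ : ZXClass 0 0) (cgl (cgl (cgr (_ : ZXClass 2 4) (cpr (_ : ZXClass 1 2) (show mk (wires 1) ⊠ mk (wires 2) = mk (wires 3) from wires_par_wires 1 2))) (_ : ZXClass 5 3)) (_ : ZXClass 3 1))))  -- wires
  have s26 := s25.trans (cpr (_ : ZXClass 0 0) (cpr (_ : ZXClass 0 0) (cgl (cgl (cgl (cgr (_ : ZXClass 2 5) (show mk (wires 1) ⊠ (mk (wires 1) ⊠ (mk (X 1 2 0) ⊠ mk (wires 1) ⨟ mk triangle ⊠ (mk (Z 2 1 0) ⨟ (mk triangle).transpose) ⨟ mk (Z 2 1 0))) ⊠ mk (wires 1) = mk (wires 1) ⊠ (mk (wires 1) ⊠ (mk (X 1 2 0) ⊠ mk (wires 1) ⨟ mk triangle ⊠ (mk (Z 2 1 0) ⨟ (mk triangle).transpose) ⨟ mk (Z 2 1 0)) ⊠ mk (wires 1)) from (par_assoc _ _ _).trans (cast_id _ _ _))) (_ : ZXClass 4 5)) (_ : ZXClass 5 3)) (_ : ZXClass 3 1))))  -- par_assoc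
  have s27 := s26.trans (cpr (_ : ZXClass 0 0) (cpr (_ : ZXClass 0 0) (cgl (cgl (show mk (wires 2) ⊠ mk cup ⨟ mk (wires 1) ⊠ (mk (X 1 2 0) ⊠ mk (wires 1)) ⊠ mk (wires 1) ⨟ mk (wires 1) ⊠ (mk (wires 1) ⊠ (mk (X 1 2 0) ⊠ mk (wires 1) ⨟ mk triangle ⊠ (mk (Z 2 1 0) ⨟ (mk triangle).transpose) ⨟ mk (Z 2 1 0)) ⊠ mk (wires 1)) ⨟ mk (Z 1 2 0) ⊠ mk (wires 3) = mk (wires 2) ⊠ mk cup ⨟ mk (wires 1) ⊠ (mk (X 1 2 0) ⊠ mk (wires 1)) ⊠ mk (wires 1) ⨟ (mk (wires 1) ⊠ (mk (wires 1) ⊠ (mk (X 1 2 0) ⊠ mk (wires 1) ⨟ mk triangle ⊠ (mk (Z 2 1 0) ⨟ (mk triangle).transpose) ⨟ mk (Z 2 1 0)) ⊠ mk (wires 1)) ⨟ mk (Z 1 2 0) ⊠ mk (wires 3)) from by simp only [seq_assoc]) (_ : ZXClass 5 3)) (_ : ZXClass 3 1))))  -- assoc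
  have s28 := s27.trans (cpr (_ : ZXClass 0 0) (cpr (_ : ZXClass 0 0) (cgl (cgl (cgr (_ : ZXClass 2 5) (show mk (wires 1) ⊠ (mk (wires 1) ⊠ (mk (X 1 2 0) ⊠ mk (wires 1) ⨟ mk triangle ⊠ (mk (Z 2 1 0) ⨟ (mk triangle).transpose) ⨟ mk (Z 2 1 0)) ⊠ mk (wires 1)) ⨟ mk (Z 1 2 0) ⊠ mk (wires 3) = mk (Z 1 2 0) ⊠ mk (wires 4) ⨟ mk (wires 2) ⊠ (mk (wires 1) ⊠ (mk (X 1 2 0) ⊠ mk (wires 1) ⨟ mk triangle ⊠ (mk (Z 2 1 0) ⨟ (mk triangle).transpose) ⨟ mk (Z 2 1 0)) ⊠ mk (wires 1)) from (slide _ _).symm)) (_ : ZXClass 5 3)) (_ : ZXClass 3 1))))  -- slide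
  have s29 := s28.trans (cpr (_ : ZXClass 0 0) (cpr (_ : ZXClass 0 0) (show mk (wires 2) ⊠ mk cup ⨟ mk (wires 1) ⊠ (mk (X 1 2 0) ⊠ mk (wires 1)) ⊠ mk (wires 1) ⨟ (mk (Z 1 2 0) ⊠ mk (wires 4) ⨟ mk (wires 2) ⊠ (mk (wires 1) ⊠ (mk (X 1 2 0) ⊠ mk (wires 1) ⨟ mk triangle ⊠ (mk (Z 2 1 0) ⨟ (mk triangle).transpose) ⨟ mk (Z 2 1 0)) ⊠ mk (wires 1))) ⨟ mk (wires 1) ⊠ mk cap ⊠ mk (wires 1) ⊠ mk (wires 1) ⨟ mk cap ⊠ mk (wires 1) = mk (wires 2) ⊠ mk cup ⨟ mk (wires 1) ⊠ (mk (X 1 2 0) ⊠ mk (wires 1)) ⊠ mk (wires 1) ⨟ mk (Z 1 2 0) ⊠ mk (wires 4) ⨟ mk (wires 2) ⊠ (mk (wires 1) ⊠ (mk (X 1 2 0) ⊠ mk (wires 1) ⨟ mk triangle ⊠ (mk (Z 2 1 0) ⨟ (mk triangle).transpose) ⨟ mk (Z 2 1 0)) ⊠ mk (wires 1)) ⨟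 mk (wires 1) ⊠ mk cap ⊠ mk (wires 1) ⊠ mk (wires 1) ⨟ mk cap ⊠ mk (wires 1) from by simp only [seq_assoc])))  -- assoc
  have s30 := s29.trans (cpr (_ : ZXClass 0 0) (cpr (_ : ZXClass 0 0) (cgl (cgl (cgl (cgl (cgr (_ : ZXClass 2 4) (show mk (wires 1) ⊠ (mk (X 1 2 0) ⊠ mk (wires 1)) ⊠ mk (wires 1) = mk (wires 1) ⊠ (mk (X 1 2 0) ⊠ mk (wires 1) ⊠ mk (wires 1)) from (par_assoc _ _ _).trans (cast_id _ _ _))) (_ : ZXClass 5 6)) (_ : ZXClass 6 5)) (_ : ZXClass 5 3)) (_ : ZXClass 3 1))))  -- par_assoc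
  have s31 := s30.trans (cpr (_ : ZXClass 0 0) (cpr (_ : ZXClass 0 0) (cgl (cgl (cgl (show mk (wires 2) ⊠ mk cup ⨟ mk (wires 1) ⊠ (mk (X 1 2 0) ⊠ mk (wires 1) ⊠ mk (wires 1)) ⨟ mk (Z 1 2 0) ⊠ mk (wires 4) = mk (wires 2) ⊠ mk cup ⨟ (mk (wires 1) ⊠ (mk (X 1 2 0) ⊠ mk (wires 1) ⊠ mk (wires 1)) ⨟ mk (Z 1 2 0) ⊠ mk (wires 4)) from by simp only [seq_assoc]) (_ : ZXClass 6 5)) (_ : ZXClass 5 3)) (_ : ZXClass 3 1))))  -- assoc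
  have s32 := s31.trans (cpr (_ : ZXClass 0 0) (cpr (_ : ZXClass 0 0) (cgl (cgl (cgl (cgr (_ : ZXClass 2 4) (show mk (wires 1) ⊠ (mk (X 1 2 0) ⊠ mk (wires 1) ⊠ mk (wires 1)) ⨟ mk (Z 1 2 0) ⊠ mk (wires 4) = mk (Z 1 2 0) ⊠ mk (wires 3) ⨟ mk (wires 2) ⊠ (mk (X 1 2 0) ⊠ mk (wires 1) ⊠ mk (wires 1)) from (slide _ _).symm)) (_ : ZXClass 6 5)) (_ : ZXClass 5 3)) (_ : ZXClass 3 1))))  -- slide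
  have s33 := s32.trans (cpr (_ : ZXClass 0 0) (cpr (_ : ZXClass 0 0) (show mk (wires 2) ⊠ mk cup ⨟ (mk (Z 1 2 0) ⊠ mk (wires 3) ⨟ mk (wires 2) ⊠ (mk (X 1 2 0) ⊠ mk (wires 1) ⊠ mk (wires 1))) ⨟ mk (wires 2) ⊠ (mk (wires 1) ⊠ (mk (X 1 2 0) ⊠ mk (wires 1) ⨟ mk triangle ⊠ (mk (Z 2 1 0) ⨟ (mk triangle).transpose) ⨟ mk (Z 2 1 0)) ⊠ mk (wires 1)) ⨟ mk (wires 1) ⊠ mk cap ⊠ mk (wires 1) ⊠ mk (wires 1) ⨟ mk cap ⊠ mk (wires 1) = mk (wires 2) ⊠ mk cup ⨟ mk (Z 1 2 0) ⊠ mk (wires 3) ⨟ mk (wires 2) ⊠ (mk (X 1 2 0) ⊠ mk (wires 1) ⊠ mk (wires 1)) ⨟ mk (wires 2) ⊠ (mk (wires 1) ⊠ (mk (X 1 2 0) ⊠ mk (wires 1) ⨟ mk triangle ⊠ (mk (Z 2 1 0) ⨟ (mk triangle).transpose) ⨟ mk (Z 2 1 0)) ⊠ mk (wires 1)) ⨟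 mk (wires 1) ⊠ mk cap ⊠ mk (wires 1) ⊠ mk (wires 1) ⨟ mk cap ⊠ mk (wires 1) from by simp only [seq_assoc])))  -- assoc
  have s34 := s33.trans (cpr (_ : ZXClass 0 0) (cpr (_ : ZXClass 0 0) (cgl (cgl (cgl (cgl (cgl (cpl (show mk (wires 2) = mk (wires 1) ⊠ mk (wires 1) from (wires_par_wires 1 1).symm) (_ : ZXClass 0 2)) (_ : ZXClass 4 5)) (_ : ZXClass 5 6)) (_ : ZXClass 6 5)) (_ : ZXClass 5 3)) (_ : ZXClass 3 1))))  -- wires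
  have s35 := s34.trans (cpr (_ : ZXClass 0 0) (cpr (_ : ZXClass 0 0) (cgl (cgl (cgl (cgl (cgl (show mk (wires 1) ⊠ mk (wires 1) ⊠ mk cup = mk (wires 1) ⊠ (mk (wires 1) ⊠ mk cup) from (par_assoc _ _ _).trans (cast_id _ _ _)) (_ : ZXClass 4 5)) (_ : ZXClass 5 6)) (_ : ZXClass 6 5)) (_ : ZXClass 5 3)) (_ : ZXClass 3 1))))  -- par_assoc
  have s36 := s35.trans (cpr (_ : ZXClass 0 0) (cpr (_ : ZXClass 0 0) (cgl (cgl (cgl (cgl (show mk (wires 1) ⊠ (mk (wires 1) ⊠ mk cup) ⨟ mk (Z 1 2 0) ⊠ mk (wires 3) = mk (Z 1 2 0) ⊠ mk (wires 1) ⨟ mk (wires 2) ⊠ (mk (wires 1) ⊠ mk cup) from (slide _ _).symm) (_ : ZXClass 5 6)) (_ : ZXClass 6 5)) (_ : ZXClass 5 3)) (_ : ZXClass 3 1))))  -- slide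
  have s37 := s36.trans (cpr (_ : ZXClass 0 0) (cpr (_ : ZXClass 0 0) (cgl (cgl (cgl (cgl (cgr (_ : ZXClass 2 3) (show mk (wires 2) ⊠ (mk (wires 1) ⊠ mk cup) = mk (wires 2) ⊠ mk (wires 1) ⊠ mk cup from (par_assoc' _ _ _).trans (cast_id _ _ _))) (_ : ZXClass 5 6)) (_ : ZXClass 6 5)) (_ : ZXClass 5 3)) (_ : ZXClass 3 1))))  -- par_assoc
  have s38 := s37.trans (cpr (_ : ZXClass 0 0) (cpr (_ : ZXClass 0 0) (cgl (cgl (cgl (cgl (cgr (_ : ZXClass 2 3) (cpl (show mk (wires 2) ⊠ mk (wires 1) = mk (wires 3) from wires_par_wires 2 1) (_ : ZXClass 0 2))) (_ : ZXClass 5 6)) (_ : ZXClass 6 5)) (_ : ZXClass 5 3)) (_ : ZXClass 3 1))))  -- wires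
  have s39 := s38.trans (cpr (_ : ZXClass 0 0) (cpr (_ : ZXClass 0 0) (cgl (cgl (cgr (_ : ZXClass 2 6) (cpr (_ : ZXClass 2 2) (show mk (wires 1) ⊠ (mk (X 1 2 0) ⊠ mk (wires 1) ⨟ mk triangle ⊠ (mk (Z 2 1 0) ⨟ (mk triangle).transpose) ⨟ mk (Z 2 1 0)) ⊠ mk (wires 1) = mk (wires 1) ⊠ ((mk (X 1 2 0) ⊠ mk (wires 1) ⨟ mk triangle ⊠ (mk (Z 2 1 0) ⨟ (mk triangle).transpose) ⨟ mk (Z 2 1 0)) ⊠ mk (wires 1)) from (par_assoc _ _ _).trans (cast_id _ _ _)))) (_ : ZXClass 5 3)) (_ : ZXClass 3 1))))  -- par_assoc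
  have s40 := s39.trans (cpr (_ : ZXClass 0 0) (cpr (_ : ZXClass 0 0) (cgl (cgl (cgr (_ : ZXClass 2 6) (show mk (wires 2) ⊠ (mk (wires 1) ⊠ ((mk (X 1 2 0) ⊠ mk (wires 1) ⨟ mk triangle ⊠ (mk (Z 2 1 0) ⨟ (mk triangle).transpose) ⨟ mk (Z 2 1 0)) ⊠ mk (wires 1))) = mk (wires 2) ⊠ mk (wires 1) ⊠ ((mk (X 1 2 0) ⊠ mk (wires 1) ⨟ mk triangle ⊠ (mk (Z 2 1 0) ⨟ (mk triangle).transpose) ⨟ mk (Z 2 1 0)) ⊠ mk (wires 1)) from (par_assoc' _ _ _).trans (cast_id _ _ _))) (_ : ZXClass 5 3)) (_ : ZXClass 3 1))))  -- par_assoc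
  have s41 := s40.trans (cpr (_ : ZXClass 0 0) (cpr (_ : ZXClass 0 0) (cgl (cgl (cgr (_ : ZXClass 2 6) (cpl (show mk (wires 2) ⊠ mk (wires 1) = mk (wires 3) from wires_par_wires 2 1) (_ : ZXClass 3 2))) (_ : ZXClass 5 3)) (_ : ZXClass 3 1))))  -- wires
  have s42 := s41.trans (cpr (_ : ZXClass 0 0) (cpr (_ : ZXClass 0 0) (cgl (cgr (_ : ZXClass 2 5) (show mk (wires 1) ⊠ mk cap ⊠ mk (wires 1) ⊠ mk (wires 1) = mk (wires 1) ⊠ mk cap ⊠ (mk (wires 1) ⊠ mk (wires 1)) from (par_assoc _ _ _).trans (cast_id _ _ _))) (_ : ZXClass 3 1))))  -- par_assoc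
  have s43 := s42.trans (cpr (_ : ZXClass 0 0) (cpr (_ : ZXClass 0 0) (cgl (cgr (_ : ZXClass 2 5) (cpr (_ : ZXClass 3 1) (show mk (wires 1) ⊠ mk (wires 1) = mk (wires 2) from wires_par_wires 1 1))) (_ : ZXClass 3 1))))  -- wires
  have s44 := s43.trans (cpr (_ : ZXClass 0 0) (cpr (_ : ZXClass 0 0) (cgl (show mk (Z 1 2 0) ⊠ mk (wires 1) ⨟ mk (wires 3) ⊠ mk cup ⨟ mk (wires 2) ⊠ (mk (X 1 2 0) ⊠ mk (wires 1) ⊠ mk (wires 1)) ⨟ mk (wires 3) ⊠ ((mk (X 1 2 0) ⊠ mk (wires 1) ⨟ mk triangle ⊠ (mk (Z 2 1 0) ⨟ (mk triangle).transpose) ⨟ mk (Z 2 1 0)) ⊠ mk (wires 1)) ⨟ mk (wires 1) ⊠ mk cap ⊠ mk (wires 2) = mk (Z 1 2 0) ⊠ mk (wires 1) ⨟ mk (wires 3) ⊠ mk cup ⨟ mk (wires 2) ⊠ (mk (X 1 2 0) ⊠ mk (wires 1) ⊠ mk (wires 1)) ⨟ (mk (wires 3) ⊠ ((mk (X 1 2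 0) ⊠ mk (wires 1) ⨟ mk triangle ⊠ (mk (Z 2 1 0) ⨟ (mk triangle).transpose) ⨟ mk (Z 2 1 0)) ⊠ mk (wires 1)) ⨟ mk (wires 1) ⊠ mk cap ⊠ mk (wires 2)) from by simp only [seq_assoc]) (_ : ZXClass 3 1))))  -- assoc
  have s45 := s44.trans (cpr (_ : ZXClass 0 0) (cpr (_ : ZXClass 0 0) (cgl (cgr (_ : ZXClass 2 6) (show mk (wires 3) ⊠ ((mk (X 1 2 0) ⊠ mk (wires 1) ⨟ mk triangle ⊠ (mk (Z 2 1 0) ⨟ (mk triangle).transpose) ⨟ mk (Z 2 1 0)) ⊠ mk (wires 1)) ⨟ mk (wires 1) ⊠ mk cap ⊠ mk (wires 2) = mk (wires 1) ⊠ mk cap ⊠ mk (wires 3) ⨟ mk (wires 1) ⊠ ((mk (X 1 2 0) ⊠ mk (wires 1) ⨟ mk triangle ⊠ (mk (Z 2 1 0) ⨟ (mk triangle).transpose) ⨟ mk (Z 2 1 0)) ⊠ mk (wires 1)) from (slide _ _).symm)) (_ : ZXClass 3 1))))  -- slide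
  have s46 := s45.trans (cpr (_ : ZXClass 0 0) (cpr (_ : ZXClass 0 0) (show mk (Z 1 2 0) ⊠ mk (wires 1) ⨟ mk (wires 3) ⊠ mk cup ⨟ mk (wires 2) ⊠ (mk (X 1 2 0) ⊠ mk (wires 1) ⊠ mk (wires 1)) ⨟ (mk (wires 1) ⊠ mk cap ⊠ mk (wires 3) ⨟ mk (wires 1) ⊠ ((mk (X 1 2 0) ⊠ mk (wires 1) ⨟ mk triangle ⊠ (mk (Z 2 1 0) ⨟ (mk triangle).transpose) ⨟ mk (Z 2 1 0)) ⊠ mk (wires 1))) ⨟ mk cap ⊠ mk (wires 1) = mk (Z 1 2 0) ⊠ mk (wires 1) ⨟ mk (wires 3) ⊠ mk cup ⨟ mk (wires 2) ⊠ (mk (X 1 2 0) ⊠ mk (wires 1) ⊠ mk (wires 1)) ⨟ mk (wires 1) ⊠ mk cap ⊠ mk (wires 3) ⨟ mk (wires 1) ⊠ ((mk (X 1 2 0) ⊠ mk (wires 1) ⨟ mk triangle ⊠ (mk (Z 2 1 0) ⨟ (mk triangle).transpose) ⨟ mk (Z 2 1 0)) ⊠ mk (wires 1)) ⨟ mk cap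 ⊠ mk (wires 1) from by simp only [seq_assoc])))  -- assoc
  have s47 := s46.trans (cpr (_ : ZXClass 0 0) (cpr (_ : ZXClass 0 0) (cgl (cgl (cgl (cgr (_ : ZXClass 2 5) (cpr (_ : ZXClass 2 2) (show mk (X 1 2 0) ⊠ mk (wires 1) ⊠ mk (wires 1) = mk (X 1 2 0) ⊠ (mk (wires 1) ⊠ mk (wires 1)) from (par_assoc _ _ _).trans (cast_id _ _ _)))) (_ : ZXClass 6 4)) (_ : ZXClass 4 3)) (_ : ZXClass 3 1))))  -- par_assoc
  have s48 := s47.trans (cpr (_ : ZXClass 0 0) (cpr (_ : ZXClass 0 0) (cgl (cgl (cgl (cgr (_ : ZXClass 2 5) (cpr (_ : ZXClass 2 2) (cpr (_ : ZXClass 1 2) (show mk (wires 1) ⊠ mk (wires 1) = mk (wires 2) from wires_par_wires 1 1)))) (_ : ZXClass 6 4)) (_ : ZXClass 4 3)) (_ : ZXClass 3 1))))  -- wires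
  have s49 := s48.trans (cpr (_ : ZXClass 0 0) (cpr (_ : ZXClass 0 0) (cgl (cgl (cgl (cgr (_ : ZXClass 2 5) (cpl (show mk (wires 2) = mk (wires 1) ⊠ mk (wires 1) from (wires_par_wires 1 1).symm) (_ : ZXClass 3 4))) (_ : ZXClass 6 4)) (_ : ZXClass 4 3)) (_ : ZXClass 3 1))))  -- wires
  have s50 := s49.trans (cpr (_ : ZXClass 0 0) (cpr (_ : ZXClass 0 0) (cgl (cgl (cgl (cgr (_ : ZXClass 2 5) (show mk (wires 1) ⊠ mk (wires 1) ⊠ (mk (X 1 2 0) ⊠ mk (wires 2)) = mk (wires 1) ⊠ (mk (wires 1) ⊠ (mk (X 1 2 0) ⊠ mk (wires 2))) from (par_assoc _ _ _).trans (cast_id _ _ _))) (_ : ZXClass 6 4)) (_ : ZXClass 4 3)) (_ : ZXClass 3 1))))  -- par_assoc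
  have s51 := s50.trans (cpr (_ : ZXClass 0 0) (cpr (_ : ZXClass 0 0) (cgl (cgl (cgl (cgr (_ : ZXClass 2 5) (cpr (_ : ZXClass 1 1) (show mk (wires 1) ⊠ (mk (X 1 2 0) ⊠ mk (wires 2)) = mk (wires 1) ⊠ mk (X 1 2 0) ⊠ mk (wires 2) from (par_assoc' _ _ _).trans (cast_id _ _ _)))) (_ : ZXClass 6 4)) (_ : ZXClass 4 3)) (_ : ZXClass 3 1))))  -- par_assoc
  have s52 := s51.trans (cpr (_ : ZXClass 0 0) (cpr (_ : ZXClass 0 0) (cgl (cgl (cgr (_ : ZXClass 2 6) (show mk (wires 1) ⊠ mk cap ⊠ mk (wires 3) = mk (wires 1) ⊠ (mk cap ⊠ mk (wires 3)) from (par_assoc _ _ _).trans (cast_id _ _ _))) (_ : ZXClass 4 3)) (_ : ZXClass 3 1))))  -- par_assoc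
  have s53 := s52.trans (cpr (_ : ZXClass 0 0) (cpr (_ : ZXClass 0 0) (cgl (cgl (cgr (_ : ZXClass 2 6) (cpr (_ : ZXClass 1 1) (cpr (_ : ZXClass 2 0) (show mk (wires 3) = mk (wires 1) ⊠ mk (wires 2) from (wires_par_wires 1 2).symm)))) (_ : ZXClass 4 3)) (_ : ZXClass 3 1))))  -- wires
  have s54 := s53.trans (cpr (_ : ZXClass 0 0) (cpr (_ : ZXClass 0 0) (cgl (cgl (cgr (_ : ZXClass 2 6) (cpr (_ : ZXClass 1 1) (show mk cap ⊠ (mk (wires 1) ⊠ mk (wires 2)) = mk cap ⊠ mk (wires 1) ⊠ mk (wires 2) from (par_assoc' _ _ _).trans (cast_id _ _ _)))) (_ : ZXClass 4 3)) (_ : ZXClass 3 1))))  -- par_assoc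
  have s55 := s54.trans (cpr (_ : ZXClass 0 0) (cpr (_ : ZXClass 0 0) (cgl (cgl (show mk (Z 1 2 0) ⊠ mk (wires 1) ⨟ mk (wires 3) ⊠ mk cup ⨟ mk (wires 1) ⊠ (mk (wires 1) ⊠ mk (X 1 2 0) ⊠ mk (wires 2)) ⨟ mk (wires 1) ⊠ (mk cap ⊠ mk (wires 1) ⊠ mk (wires 2)) = mk (Z 1 2 0) ⊠ mk (wires 1) ⨟ mk (wires 3) ⊠ mk cup ⨟ (mk (wires 1) ⊠ (mk (wires 1) ⊠ mk (X 1 2 0) ⊠ mk (wires 2)) ⨟ mk (wires 1) ⊠ (mk cap ⊠ mk (wires 1) ⊠ mk (wires 2))) from by simp only [seq_assoc]) (_ : ZXClass 4 3)) (_ : ZXClass 3 1))))  -- assoc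
  have s56 := s55.trans (cpr (_ : ZXClass 0 0) (cpr (_ : ZXClass 0 0) (cgl (cgl (cgr (_ : ZXClass 2 5) (show mk (wires 1) ⊠ (mk (wires 1) ⊠ mk (X 1 2 0) ⊠ mk (wires 2)) ⨟ mk (wires 1) ⊠ (mk cap ⊠ mk (wires 1) ⊠ mk (wires 2)) = mk (wires 1) ⊠ (mk (wires 1) ⊠ mk (X 1 2 0) ⊠ mk (wires 2) ⨟ mk cap ⊠ mk (wires 1) ⊠ mk (wires 2)) from (wires_par_seq 1 _ _).symm)) (_ : ZXClass 4 3)) (_ : ZXClass 3 1))))  -- wires_par_seq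
  have s57 := s56.trans (cpr (_ : ZXClass 0 0) (cpr (_ : ZXClass 0 0) (cgl (cgl (cgr (_ : ZXClass 2 5) (cpr (_ : ZXClass 1 1) (show mk (wires 1) ⊠ mk (X 1 2 0) ⊠ mk (wires 2) ⨟ mk cap ⊠ mk (wires 1) ⊠ mk (wires 2) = (mk (wires 1) ⊠ mk (X 1 2 0) ⨟ mk cap ⊠ mk (wires 1)) ⊠ mk (wires 2) from (seq_par_wires _ _ 2).symm))) (_ : ZXClass 4 3)) (_ : ZXClass 3 1))))  -- seq_par_wires
  have s58 := s57.trans (cpr (_ : ZXClass 0 0) (cpr (_ : ZXClass 0 0) (cgl (cgl (cgr (_ : ZXClass 2 5) (cpr (_ : ZXClass 1 1) (cpl (show mk (wires 1) ⊠ mk (X 1 2 0) ⨟ mk cap ⊠ mk (wires 1) = mk (X 2 1 0) from par_xsplit_seq_cap_par) (_ : ZXClass 2 2)))) (_ : ZXClass 4 3)) (_ : ZXClass 3 1))))  -- par_xsplit_seq_cap_par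
  have s59 := s58.trans (cpr (_ : ZXClass 0 0) (cpr (_ : ZXClass 0 0) (cgl (cgl (cgr (_ : ZXClass 2 5) (show mk (wires 1) ⊠ (mk (X 2 1 0) ⊠ mk (wires 2)) = mk (wires 1) ⊠ mk (X 2 1 0) ⊠ mk (wires 2) from (par_assoc' _ _ _).trans (cast_id _ _ _))) (_ : ZXClass 4 3)) (_ : ZXClass 3 1))))  -- par_assoc
  have s60 := s59.trans (cpr (_ : ZXClass 0 0) (cpr (_ : ZXClass 0 0) (cgl (cgl (show mk (Z 1 2 0) ⊠ mk (wires 1) ⨟ mk (wires 3) ⊠ mk cup ⨟ mk (wires 1) ⊠ mk (X 2 1 0) ⊠ mk (wires 2) = mk (Z 1 2 0) ⊠ mk (wires 1) ⨟ (mk (wires 3) ⊠ mk cup ⨟ mk (wires 1) ⊠ mk (X 2 1 0) ⊠ mk (wires 2)) from by simp only [seq_assoc]) (_ : ZXClass 4 3)) (_ : ZXClass 3 1))))  -- assoc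
  have s61 := s60.trans (cpr (_ : ZXClass 0 0) (cpr (_ : ZXClass 0 0) (cgl (cgl (cgr (_ : ZXClass 2 3) (show mk (wires 3) ⊠ mk cup ⨟ mk (wires 1) ⊠ mk (X 2 1 0) ⊠ mk (wires 2) = mk (wires 1) ⊠ mk (X 2 1 0) ⊠ mk (wires 0) ⨟ mk (wires 2) ⊠ mk cup from (slide _ _).symm)) (_ : ZXClass 4 3)) (_ : ZXClass 3 1))))  -- slide
  have s62 := s61.trans (cpr (_ : ZXClass 0 0) (cpr (_ : ZXClass 0 0) (cgl (cgl (cgr (_ : ZXClass 2 3) (cgl (show mk (wires 1) ⊠ mk (X 2 1 0) ⊠ mk (wires 0) = mk (wires 1) ⊠ mk (X 2 1 0) from par_empty _) (_ : ZXClass 2 4))) (_ : ZXClass 4 3)) (_ : ZXClass 3 1))))  -- par_empty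
  have s63 := s62.trans (cpr (_ : ZXClass 0 0) (cpr (_ : ZXClass 0 0) (show mk (Z 1 2 0) ⊠ mk (wires 1) ⨟ (mk (wires 1) ⊠ mk (X 2 1 0) ⨟ mk (wires 2) ⊠ mk cup) ⨟ mk (wires 1) ⊠ ((mk (X 1 2 0) ⊠ mk (wires 1) ⨟ mk triangle ⊠ (mk (Z 2 1 0) ⨟ (mk triangle).transpose) ⨟ mk (Z 2 1 0)) ⊠ mk (wires 1)) ⨟ mk cap ⊠ mk (wires 1) = mk (Z 1 2 0) ⊠ mk (wires 1) ⨟ mk (wires 1) ⊠ mk (X 2 1 0) ⨟ mk (wires 2) ⊠ mk cup ⨟ mk (wires 1) ⊠ ((mk (X 1 2 0) ⊠ mk (wires 1) ⨟ mk triangle ⊠ (mk (Z 2 1 0) ⨟ (mk triangle).transpose) ⨟ mk (Z 2 1 0)) ⊠ mk (wires 1)) ⨟ mk cap ⊠ mk (wires 1) from by simp only [seq_assoc])))  -- assoc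
  have s64 := s63.trans (cpr (_ : ZXClass 0 0) (cpr (_ : ZXClass 0 0) (cgl (cgr (_ : ZXClass 2 4) (show mk (wires 1) ⊠ ((mk (X 1 2 0) ⊠ mk (wires 1) ⨟ mk triangle ⊠ (mk (Z 2 1 0) ⨟ (mk triangle).transpose) ⨟ mk (Z 2 1 0)) ⊠ mk (wires 1)) = mk (wires 1) ⊠ (mk (X 1 2 0) ⊠ mk (wires 1) ⨟ mk triangle ⊠ (mk (Z 2 1 0) ⨟ (mk triangle).transpose) ⨟ mk (Z 2 1 0)) ⊠ mk (wires 1) from (par_assoc' _ _ _).trans (cast_id _ _ _))) (_ : ZXClass 3 1))))  -- par_assoc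
  have s65 := s64.trans (cpr (_ : ZXClass 0 0) (show mk (dumbbell 0 0) ⊠ (mk (Z 1 2 0) ⊠ mk (wires 1) ⨟ mk (wires 1) ⊠ mk (X 2 1 0) ⨟ mk (wires 2) ⊠ mk cup ⨟ mk (wires 1) ⊠ (mk (X 1 2 0) ⊠ mk (wires 1) ⨟ mk triangle ⊠ (mk (Z 2 1 0) ⨟ (mk triangle).transpose) ⨟ mk (Z 2 1 0)) ⊠ mk (wires 1) ⨟ mk cap ⊠ mk (wires 1)) = mk (dumbbell 0 0) ⊠ (mk (Z 1 2 0) ⊠ mk (wires 1) ⨟ mk (wires 1) ⊠ mk (X 2 1 0) ⨟ mk (wires 2) ⊠ mk cup ⨟ mk (wires 1) ⊠ (mk (X 1 2 0) ⊠ mk (wires 1) ⨟ mk triangle ⊠ (mk (Z 2 1 0) ⨟ (mk triangle).transpose) ⨟ mk (Z 2 1 0)) ⊠ mk (wires 1)) ⨟ mk cap ⊠ mk (wires 1) from by rw [scalar_par_seq_left (mk (dumbbell 0 0)) (mk (Z 1 2 0) ⊠ mk (wires 1) ⨟ mk (wires 1) ⊠ mk (X 2 1 0) ⨟ mk (wires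 2) ⊠ mk cup ⨟ mk (wires 1) ⊠ (mk (X 1 2 0) ⊠ mk (wires 1) ⨟ mk triangle ⊠ (mk (Z 2 1 0) ⨟ (mk triangle).transpose) ⨟ mk (Z 2 1 0)) ⊠ mk (wires 1)) (mk cap ⊠ mk (wires 1)), empty_par, cast_id]))  -- scalar
  have s66 := s65.trans (cpr (_ : ZXClass 0 0) (cgl (show mk (dumbbell 0 0) ⊠ (mk (Z 1 2 0) ⊠ mk (wires 1) ⨟ mk (wires 1) ⊠ mk (X 2 1 0) ⨟ mk (wires 2) ⊠ mk cup ⨟ mk (wires 1) ⊠ (mk (X 1 2 0) ⊠ mk (wires 1) ⨟ mk triangle ⊠ (mk (Z 2 1 0) ⨟ (mk triangle).transpose) ⨟ mk (Z 2 1 0)) ⊠ mk (wires 1)) = mk (Z 1 2 0) ⊠ mk (wires 1) ⨟ mk (wires 1) ⊠ mk (X 2 1 0) ⨟ mk (wires 2) ⊠ mk cup ⨟ mk (dumbbell 0 0) ⊠ (mk (wires 1) ⊠ (mk (X 1 2 0) ⊠ mk (wires 1) ⨟ mk triangle ⊠ (mk (Z 2 1 0) ⨟ (mk triangle).transpose)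 ⨟ mk (Z 2 1 0)) ⊠ mk (wires 1)) from by rw [scalar_par_seq_right (mk (dumbbell 0 0)) (mk (Z 1 2 0) ⊠ mk (wires 1) ⨟ mk (wires 1) ⊠ mk (X 2 1 0) ⨟ mk (wires 2) ⊠ mk cup) (mk (wires 1) ⊠ (mk (X 1 2 0) ⊠ mk (wires 1) ⨟ mk triangle ⊠ (mk (Z 2 1 0) ⨟ (mk triangle).transpose) ⨟ mk (Z 2 1 0)) ⊠ mk (wires 1)), empty_par, cast_id]) (_ : ZXClass 3 1)))  -- scalar
  have s67 := s66.trans (cpr (_ : ZXClass 0 0) (cgl (cgr (_ : ZXClass 2 4) (show mk (dumbbell 0 0) ⊠ (mk (wires 1) ⊠ (mk (X 1 2 0) ⊠ mk (wires 1) ⨟ mk triangle ⊠ (mk (Z 2 1 0) ⨟ (mk triangle).transpose) ⨟ mk (Z 2 1 0)) ⊠ mk (wires 1)) = mk (dumbbell 0 0) ⊠ (mk (wires 1) ⊠ (mk (X 1 2 0) ⊠ mk (wires 1) ⨟ mk triangle ⊠ (mk (Z 2 1 0) ⨟ (mk triangle).transpose) ⨟ mk (Z 2 1 0))) ⊠ mk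 (wires 1) from (par_assoc' _ _ _).trans (cast_id _ _ _))) (_ : ZXClass 3 1)))  -- scalar
  have s68 := s67.trans (cpr (_ : ZXClass 0 0) (cgl (cgr (_ : ZXClass 2 4) (cpl (show mk (dumbbell 0 0) ⊠ (mk (wires 1) ⊠ (mk (X 1 2 0) ⊠ mk (wires 1) ⨟ mk triangle ⊠ (mk (Z 2 1 0) ⨟ (mk triangle).transpose) ⨟ mk (Z 2 1 0))) = mk (wires 1) ⊠ (mk (dumbbell 0 0) ⊠ (mk (X 1 2 0) ⊠ mk (wires 1) ⨟ mk triangle ⊠ (mk (Z 2 1 0) ⨟ (mk triangle).transpose) ⨟ mk (Z 2 1 0))) from ((par_assoc' _ _ _).trans (cast_id _ _ _)).trans ((cpl (scalar_par_wires _) _).trans ((par_assoc _ _ _).trans (cast_id _ _ _)))) (_ : ZXClass 1 1))) (_ : ZXClass 3 1)))  -- scalar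
  have s69 := s68.trans (cpr (_ : ZXClass 0 0) (show mk (Z 1 2 0) ⊠ mk (wires 1) ⨟ mk (wires 1) ⊠ mk (X 2 1 0) ⨟ mk (wires 2) ⊠ mk cup ⨟ mk (wires 1) ⊠ (mk (dumbbell 0 0) ⊠ (mk (X 1 2 0) ⊠ mk (wires 1) ⨟ mk triangle ⊠ (mk (Z 2 1 0) ⨟ (mk triangle).transpose) ⨟ mk (Z 2 1 0))) ⊠ mk (wires 1) ⨟ mk cap ⊠ mk (wires 1) = mk (Z 1 2 0) ⊠ mk (wires 1) ⨟ mk (wires 1) ⊠ mk (X 2 1 0) ⨟ (mk (wires 2) ⊠ mk cup ⨟ mk (wires 1) ⊠ (mk (dumbbell 0 0) ⊠ (mk (X 1 2 0) ⊠ mk (wires 1) ⨟ mk triangle ⊠ (mk (Z 2 1 0) ⨟ (mk triangle).transpose) ⨟ mk (Z 2 1 0))) ⊠ mk (wires 1) ⨟ mk cap ⊠ mk (wires 1)) from by simp only [seq_assoc]))  -- assoc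
  have s70 := s69.trans (cpr (_ : ZXClass 0 0) (cgr (_ : ZXClass 2 2) (show mk (wires 2) ⊠ mk cup ⨟ mk (wires 1) ⊠ (mk (dumbbell 0 0) ⊠ (mk (X 1 2 0) ⊠ mk (wires 1) ⨟ mk triangle ⊠ (mk (Z 2 1 0) ⨟ (mk triangle).transpose) ⨟ mk (Z 2 1 0))) ⊠ mk (wires 1) ⨟ mk cap ⊠ mk (wires 1) = mk switch from flat_core_eq_switch)))  -- flat_core_eq_switch
  have s71 := s70.trans ((show mk (dumbbell 0 0) ⊠ (mk (Z 1 2 0) ⊠ mk (wires 1) ⨟ mk (wires 1) ⊠ mk (X 2 1 0) ⨟ mk switch) = mk (dumbbell 0 0) ⊠ (mk (Z 1 2 0) ⊠ mk (wires 1) ⨟ mk (wires 1) ⊠ mk (X 2 1 0)) ⨟ mk switch from by rw [scalar_par_seq_left (mk (dumbbell 0 0)) (mk (Z 1 2 0) ⊠ mk (wires 1) ⨟ mk (wires 1) ⊠ mk (X 2 1 0)) (mk switch), empty_par, cast_id]))  -- scalar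
  have s72 := s71.trans (cgl (show mk (dumbbell 0 0) ⊠ (mk (Z 1 2 0) ⊠ mk (wires 1) ⨟ mk (wires 1) ⊠ mk (X 2 1 0)) = mk (Z 1 2 0) ⊠ mk (wires 1) ⨟ mk (dumbbell 0 0) ⊠ (mk (wires 1) ⊠ mk (X 2 1 0)) from by rw [scalar_par_seq_right (mk (dumbbell 0 0)) (mk (Z 1 2 0) ⊠ mk (wires 1)) (mk (wires 1) ⊠ mk (X 2 1 0)), empty_par, cast_id]) (_ : ZXClass 2 1))  -- scalar
  have s73 := s72.trans (cgl (cgr (_ : ZXClass 2 3) (show mk (dumbbell 0 0) ⊠ (mk (wires 1) ⊠ mk (X 2 1 0)) = mk (wires 1) ⊠ (mk (dumbbell 0 0) ⊠ mk (X 2 1 0)) from ((par_assoc' _ _ _).trans (cast_id _ _ _)).trans ((cpl (scalar_par_wires _) _).trans ((par_assoc _ _ _).trans (cast_id _ _ _))))) (_ : ZXClass 2 1))  -- scalar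
  exact s73

/-- The bent right-hand side of `swapped-CNOT-under-controlsep` is the switch with a red `π` on its control. [cite: JeandelPerdrixVilmart2019, Appendix B, Lemma `swapped-CNOT-under-controlsep`; JeandelPerdrixVilmart2018, §2.2] -/
theorem flat_swappedCNOT_rhs : mk (wires 2) ⊠ mk cup ⨟ mk (wires 1) ⊠ (mk (dumbbell 0 0) ⊠ (mk (X 1 2 4) ⊠ mk (wires 1) ⨟ mk triangle ⊠ (mk (Z 2 1 0) ⨟ (mk triangle).transpose) ⨟ mk (Z 2 1 0))) ⊠ mk (wires 1) ⨟ mk cap ⊠ mk (wires 1) = mk (wires 1) ⊠ mk (X 1 1 4) ⨟ mk switch := by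
  have s0 : mk (wires 2) ⊠ mk cup ⨟ mk (wires 1) ⊠ (mk (dumbbell 0 0) ⊠ (mk (X 1 2 4) ⊠ mk (wires 1) ⨟ mk triangle ⊠ (mk (Z 2 1 0) ⨟ (mk triangle).transpose) ⨟ mk (Z 2 1 0))) ⊠ mk (wires 1) ⨟ mk cap ⊠ mk (wires 1) = _ := cgl (cgr (_ : ZXClass 2 4) (cpl (show mk (wires 1) ⊠ (mk (dumbbell 0 0) ⊠ (mk (X 1 2 4) ⊠ mk (wires 1) ⨟ mk triangle ⊠ (mk (Z 2 1 0) ⨟ (mk triangle).transpose) ⨟ mk (Z 2 1 0))) = mk (dumbbell 0 0) ⊠ (mk (wires 1) ⊠ (mk (X 1 2 4) ⊠ mk (wires 1) ⨟ mk triangle ⊠ (mk (Z 2 1 0) ⨟ (mk triangle).transpose) ⨟ mk (Z 2 1 0))) from ((par_assoc' _ _ _).trans (cast_id _ _ _)).trans ((cpl (scalar_par_wires _).symm _).trans ((par_assoc _ _ _).trans (cast_id _ _ _)))) (_ : ZXClass 1 1))) (_ : ZXClass 3 1)  -- scalar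
  have s1 := s0.trans (cgl (cgr (_ : ZXClass 2 4) (show mk (dumbbell 0 0) ⊠ (mk (wires 1) ⊠ (mk (X 1 2 4) ⊠ mk (wires 1) ⨟ mk triangle ⊠ (mk (Z 2 1 0) ⨟ (mk triangle).transpose) ⨟ mk (Z 2 1 0))) ⊠ mk (wires 1) = mk (dumbbell 0 0) ⊠ (mk (wires 1) ⊠ (mk (X 1 2 4) ⊠ mk (wires 1) ⨟ mk triangle ⊠ (mk (Z 2 1 0) ⨟ (mk triangle).transpose) ⨟ mk (Z 2 1 0)) ⊠ mk (wires 1)) from (par_assoc _ _ _).trans (cast_id _ _ _))) (_ : ZXClass 3 1))  -- scalar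
  have s2 := s1.trans (cgl (show mk (wires 2) ⊠ mk cup ⨟ mk (dumbbell 0 0) ⊠ (mk (wires 1) ⊠ (mk (X 1 2 4) ⊠ mk (wires 1) ⨟ mk triangle ⊠ (mk (Z 2 1 0) ⨟ (mk triangle).transpose) ⨟ mk (Z 2 1 0)) ⊠ mk (wires 1)) = mk (dumbbell 0 0) ⊠ (mk (wires 2) ⊠ mk cup ⨟ mk (wires 1) ⊠ (mk (X 1 2 4) ⊠ mk (wires 1) ⨟ mk triangle ⊠ (mk (Z 2 1 0) ⨟ (mk triangle).transpose) ⨟ mk (Z 2 1 0)) ⊠ mk (wires 1)) from by rw [scalar_par_seq_right (mk (dumbbell 0 0)) (mk (wires 2) ⊠ mk cup) (mk (wires 1) ⊠ (mk (X 1 2 4) ⊠ mk (wires 1) ⨟ mk triangle ⊠ (mk (Z 2 1 0) ⨟ (mk triangle).transpose) ⨟ mk (Z 2 1 0)) ⊠ mk (wires 1)), empty_par, cast_id]) (_ : ZXClass 3 1))  -- scalar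
  have s3 := s2.trans ((show mk (dumbbell 0 0) ⊠ (mk (wires 2) ⊠ mk cup ⨟ mk (wires 1) ⊠ (mk (X 1 2 4) ⊠ mk (wires 1) ⨟ mk triangle ⊠ (mk (Z 2 1 0) ⨟ (mk triangle).transpose) ⨟ mk (Z 2 1 0)) ⊠ mk (wires 1)) ⨟ mk cap ⊠ mk (wires 1) = mk (dumbbell 0 0) ⊠ (mk (wires 2) ⊠ mk cup ⨟ mk (wires 1) ⊠ (mk (X 1 2 4) ⊠ mk (wires 1) ⨟ mk triangle ⊠ (mk (Z 2 1 0) ⨟ (mk triangle).transpose) ⨟ mk (Z 2 1 0)) ⊠ mk (wires 1) ⨟ mk cap ⊠ mk (wires 1)) from by rw [scalar_par_seq_left (mk (dumbbell 0 0)) (mk (wires 2) ⊠ mk cup ⨟ mk (wires 1) ⊠ (mk (X 1 2 4) ⊠ mk (wires 1) ⨟ mk triangle ⊠ (mk (Z 2 1 0) ⨟ (mk triangle).transpose) ⨟ mk (Z 2 1 0)) ⊠ mk (wires 1)) (mk cap ⊠ mk (wires 1)), empty_par, cast_id]))  -- scalar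
  have s4 := s3.trans (cpr (_ : ZXClass 0 0) (cgl (cgr (_ : ZXClass 2 4) (cpl (cpr (_ : ZXClass 1 1) (cgl (cgl (cpl (show mk (X 1 2 4) = mk (X 1 1 4) ⨟ mk (X 1 2 0) from ((X_seq_X 1 1 2 le_rfl 4 0)).symm) (_ : ZXClass 1 1)) (_ : ZXClass 3 2)) (_ : ZXClass 2 1))) (_ : ZXClass 1 1))) (_ : ZXClass 3 1)))  -- X_pi_seq_X12⁻¹
  have s5 := s4.trans (cpr (_ : ZXClass 0 0) (cgl (cgr (_ : ZXClass 2 4) (cpl (cpr (_ : ZXClass 1 1) (cgl (cgl (show (mk (X 1 1 4) ⨟ mk (X 1 2 0)) ⊠ mk (wires 1) = mk (X 1 1 4) ⊠ mk (wires 1) ⨟ mk (X 1 2 0) ⊠ mk (wires 1) from by simp only [seq_par_wires]) (_ : ZXClass 3 2)) (_ : ZXClass 2 1))) (_ : ZXClass 1 1))) (_ : ZXClass 3 1)))  -- seq_par_wires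
  have s6 := s5.trans (cpr (_ : ZXClass 0 0) (cgl (cgr (_ : ZXClass 2 4) (cpl (cpr (_ : ZXClass 1 1) (show mk (X 1 1 4) ⊠ mk (wires 1) ⨟ mk (X 1 2 0) ⊠ mk (wires 1) ⨟ mk triangle ⊠ (mk (Z 2 1 0) ⨟ (mk triangle).transpose) ⨟ mk (Z 2 1 0) = mk (X 1 1 4) ⊠ mk (wires 1) ⨟ (mk (X 1 2 0) ⊠ mk (wires 1) ⨟ mk triangle ⊠ (mk (Z 2 1 0) ⨟ (mk triangle).transpose) ⨟ mk (Z 2 1 0)) from by simp only [seq_assoc])) (_ : ZXClass 1 1))) (_ : ZXClass 3 1)))  -- assoc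
  have s7 := s6.trans (cpr (_ : ZXClass 0 0) (cgl (cgr (_ : ZXClass 2 4) (cpl (show mk (wires 1) ⊠ (mk (X 1 1 4) ⊠ mk (wires 1) ⨟ (mk (X 1 2 0) ⊠ mk (wires 1) ⨟ mk triangle ⊠ (mk (Z 2 1 0) ⨟ (mk triangle).transpose) ⨟ mk (Z 2 1 0))) = mk (wires 1) ⊠ (mk (X 1 1 4) ⊠ mk (wires 1)) ⨟ mk (wires 1) ⊠ (mk (X 1 2 0) ⊠ mk (wires 1) ⨟ mk triangle ⊠ (mk (Z 2 1 0) ⨟ (mk triangle).transpose) ⨟ mk (Z 2 1 0)) from by simp only [wires_par_seq]) (_ : ZXClass 1 1))) (_ : ZXClass 3 1)))  -- wires_par_seq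
  have s8 := s7.trans (cpr (_ : ZXClass 0 0) (cgl (cgr (_ : ZXClass 2 4) (show (mk (wires 1) ⊠ (mk (X 1 1 4) ⊠ mk (wires 1)) ⨟ mk (wires 1) ⊠ (mk (X 1 2 0) ⊠ mk (wires 1) ⨟ mk triangle ⊠ (mk (Z 2 1 0) ⨟ (mk triangle).transpose) ⨟ mk (Z 2 1 0))) ⊠ mk (wires 1) = mk (wires 1) ⊠ (mk (X 1 1 4) ⊠ mk (wires 1)) ⊠ mk (wires 1) ⨟ mk (wires 1) ⊠ (mk (X 1 2 0) ⊠ mk (wires 1) ⨟ mk triangle ⊠ (mk (Z 2 1 0) ⨟ (mk triangle).transpose) ⨟ mk (Z 2 1 0)) ⊠ mk (wires 1) from by simp only [seq_par_wires])) (_ : ZXClass 3 1)))  -- seq_par_wires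
  have s9 := s8.trans (cpr (_ : ZXClass 0 0) (show mk (wires 2) ⊠ mk cup ⨟ (mk (wires 1) ⊠ (mk (X 1 1 4) ⊠ mk (wires 1)) ⊠ mk (wires 1) ⨟ mk (wires 1) ⊠ (mk (X 1 2 0) ⊠ mk (wires 1) ⨟ mk triangle ⊠ (mk (Z 2 1 0) ⨟ (mk triangle).transpose) ⨟ mk (Z 2 1 0)) ⊠ mk (wires 1)) ⨟ mk cap ⊠ mk (wires 1) = mk (wires 2) ⊠ mk cup ⨟ mk (wires 1) ⊠ (mk (X 1 1 4) ⊠ mk (wires 1)) ⊠ mk (wires 1) ⨟ mk (wires 1) ⊠ (mk (X 1 2 0) ⊠ mk (wires 1) ⨟ mk triangle ⊠ (mk (Z 2 1 0) ⨟ (mk triangle).transpose) ⨟ mk (Z 2 1 0)) ⊠ mk (wires 1) ⨟ mk cap ⊠ mk (wires 1) from by simp only [seq_assoc]))  -- assoc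
  have s10 := s9.trans (cpr (_ : ZXClass 0 0) (cgl (cgl (cgr (_ : ZXClass 2 4) (cpl (show mk (wires 1) ⊠ (mk (X 1 1 4) ⊠ mk (wires 1)) = mk (wires 1) ⊠ mk (X 1 1 4) ⊠ mk (wires 1) from (par_assoc' _ _ _).trans (cast_id _ _ _)) (_ : ZXClass 1 1))) (_ : ZXClass 4 3)) (_ : ZXClass 3 1)))  -- par_assoc
  have s11 := s10.trans (cpr (_ : ZXClass 0 0) (cgl (cgl (cgr (_ : ZXClass 2 4) (show mk (wires 1) ⊠ mk (X 1 1 4) ⊠ mk (wires 1) ⊠ mk (wires 1) = mk (wires 1) ⊠ mk (X 1 1 4) ⊠ (mk (wires 1) ⊠ mk (wires 1)) from (par_assoc _ _ _).trans (cast_id _ _ _))) (_ : ZXClass 4 3)) (_ : ZXClass 3 1)))  -- par_assoc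
  have s12 := s11.trans (cpr (_ : ZXClass 0 0) (cgl (cgl (cgr (_ : ZXClass 2 4) (cpr (_ : ZXClass 2 2) (show mk (wires 1) ⊠ mk (wires 1) = mk (wires 2) from wires_par_wires 1 1))) (_ : ZXClass 4 3)) (_ : ZXClass 3 1)))  -- wires
  have s13 := s12.trans (cpr (_ : ZXClass 0 0) (cgl (cgl (show mk (wires 2) ⊠ mk cup ⨟ mk (wires 1) ⊠ mk (X 1 1 4) ⊠ mk (wires 2) = mk (wires 1) ⊠ mk (X 1 1 4) ⊠ mk (wires 0) ⨟ mk (wires 2) ⊠ mk cup from (slide _ _).symm) (_ : ZXClass 4 3)) (_ : ZXClass 3 1)))  -- slide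
  have s14 := s13.trans (cpr (_ : ZXClass 0 0) (cgl (cgl (cgl (show mk (wires 1) ⊠ mk (X 1 1 4) ⊠ mk (wires 0) = mk (wires 1) ⊠ mk (X 1 1 4) from par_empty _) (_ : ZXClass 2 4)) (_ : ZXClass 4 3)) (_ : ZXClass 3 1)))  -- par_empty
  have s15 := s14.trans ((show mk (dumbbell 0 0) ⊠ (mk (wires 1) ⊠ mk (X 1 1 4) ⨟ mk (wires 2) ⊠ mk cup ⨟ mk (wires 1) ⊠ (mk (X 1 2 0) ⊠ mk (wires 1) ⨟ mk triangle ⊠ (mk (Z 2 1 0) ⨟ (mk triangle).transpose) ⨟ mk (Z 2 1 0)) ⊠ mk (wires 1) ⨟ mk cap ⊠ mk (wires 1)) = mk (dumbbell 0 0) ⊠ (mk (wires 1) ⊠ mk (X 1 1 4) ⨟ mk (wires 2) ⊠ mk cup ⨟ mk (wires 1) ⊠ (mk (X 1 2 0) ⊠ mk (wires 1) ⨟ mk triangle ⊠ (mk (Z 2 1 0) ⨟ (mk triangle).transpose) ⨟ mk (Z 2 1 0)) ⊠ mk (wires 1)) ⨟ mk cap ⊠ mk (wires 1) from by rw [scalar_par_seq_left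 (mk (dumbbell 0 0)) (mk (wires 1) ⊠ mk (X 1 1 4) ⨟ mk (wires 2) ⊠ mk cup ⨟ mk (wires 1) ⊠ (mk (X 1 2 0) ⊠ mk (wires 1) ⨟ mk triangle ⊠ (mk (Z 2 1 0) ⨟ (mk triangle).transpose) ⨟ mk (Z 2 1 0)) ⊠ mk (wires 1)) (mk cap ⊠ mk (wires 1)), empty_par, cast_id]))  -- scalar
  have s16 := s15.trans (cgl (show mk (dumbbell 0 0) ⊠ (mk (wires 1) ⊠ mk (X 1 1 4) ⨟ mk (wires 2) ⊠ mk cup ⨟ mk (wires 1) ⊠ (mk (X 1 2 0) ⊠ mk (wires 1) ⨟ mk triangle ⊠ (mk (Z 2 1 0) ⨟ (mk triangle).transpose) ⨟ mk (Z 2 1 0)) ⊠ mk (wires 1)) = mk (wires 1) ⊠ mk (X 1 1 4) ⨟ mk (wires 2) ⊠ mk cup ⨟ mk (dumbbell 0 0) ⊠ (mk (wires 1) ⊠ (mk (X 1 2 0) ⊠ mk (wires 1) ⨟ mk triangle ⊠ (mk (Z 2 1 0) ⨟ (mk triangle).transpose) ⨟ mk (Z 2 1 0)) ⊠ mk (wires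 1)) from by rw [scalar_par_seq_right (mk (dumbbell 0 0)) (mk (wires 1) ⊠ mk (X 1 1 4) ⨟ mk (wires 2) ⊠ mk cup) (mk (wires 1) ⊠ (mk (X 1 2 0) ⊠ mk (wires 1) ⨟ mk triangle ⊠ (mk (Z 2 1 0) ⨟ (mk triangle).transpose) ⨟ mk (Z 2 1 0)) ⊠ mk (wires 1)), empty_par, cast_id]) (_ : ZXClass 3 1))  -- scalar
  have s17 := s16.trans (cgl (cgr (_ : ZXClass 2 4) (show mk (dumbbell 0 0) ⊠ (mk (wires 1) ⊠ (mk (X 1 2 0) ⊠ mk (wires 1) ⨟ mk triangle ⊠ (mk (Z 2 1 0) ⨟ (mk triangle).transpose) ⨟ mk (Z 2 1 0)) ⊠ mk (wires 1)) = mk (dumbbell 0 0) ⊠ (mk (wires 1) ⊠ (mk (X 1 2 0) ⊠ mk (wires 1) ⨟ mk triangle ⊠ (mk (Z 2 1 0) ⨟ (mk triangle).transpose) ⨟ mk (Z 2 1 0))) ⊠ mk (wires 1) from (par_assoc' _ _ _).trans (cast_id _ _ _))) (_ : ZXClass 3 1))  -- scalar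
  have s18 := s17.trans (cgl (cgr (_ : ZXClass 2 4) (cpl (show mk (dumbbell 0 0) ⊠ (mk (wires 1) ⊠ (mk (X 1 2 0) ⊠ mk (wires 1) ⨟ mk triangle ⊠ (mk (Z 2 1 0) ⨟ (mk triangle).transpose) ⨟ mk (Z 2 1 0))) = mk (wires 1) ⊠ (mk (dumbbell 0 0) ⊠ (mk (X 1 2 0) ⊠ mk (wires 1) ⨟ mk triangle ⊠ (mk (Z 2 1 0) ⨟ (mk triangle).transpose) ⨟ mk (Z 2 1 0))) from ((par_assoc' _ _ _).trans (cast_id _ _ _)).trans ((cpl (scalar_par_wires _) _).trans ((par_assoc _ _ _).trans (cast_id _ _ _)))) (_ : ZXClass 1 1))) (_ : ZXClass 3 1))  -- scalar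
  have s19 := s18.trans ((show mk (wires 1) ⊠ mk (X 1 1 4) ⨟ mk (wires 2) ⊠ mk cup ⨟ mk (wires 1) ⊠ (mk (dumbbell 0 0) ⊠ (mk (X 1 2 0) ⊠ mk (wires 1) ⨟ mk triangle ⊠ (mk (Z 2 1 0) ⨟ (mk triangle).transpose) ⨟ mk (Z 2 1 0))) ⊠ mk (wires 1) ⨟ mk cap ⊠ mk (wires 1) = mk (wires 1) ⊠ mk (X 1 1 4) ⨟ (mk (wires 2) ⊠ mk cup ⨟ mk (wires 1) ⊠ (mk (dumbbell 0 0) ⊠ (mk (X 1 2 0) ⊠ mk (wires 1) ⨟ mk triangle ⊠ (mk (Z 2 1 0) ⨟ (mk triangle).transpose) ⨟ mk (Z 2 1 0))) ⊠ mk (wires 1) ⨟ mk cap ⊠ mk (wires 1)) from by simp only [seq_assoc]))  -- assoc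
  have s20 := s19.trans (cgr (_ : ZXClass 2 2) (show mk (wires 2) ⊠ mk cup ⨟ mk (wires 1) ⊠ (mk (dumbbell 0 0) ⊠ (mk (X 1 2 0) ⊠ mk (wires 1) ⨟ mk triangle ⊠ (mk (Z 2 1 0) ⨟ (mk triangle).transpose) ⨟ mk (Z 2 1 0))) ⊠ mk (wires 1) ⨟ mk cap ⊠ mk (wires 1) = mk switch from flat_core_eq_switch))  -- flat_core_eq_switch
  exact s20

/-- `swapped-CNOT-under-controlsep` with the crossing-free left-hand side. [cite: JeandelPerdrixVilmart2019, Appendix B, Lemma `swapped-CNOT-under-controlsep`] -/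
theorem swappedCNOT_core : mk (dumbbell 0 0) ⊠ (mk (X 1 2 0) ⊠ mk (wires 1) ⨟ mk (wires 1) ⊠ (mk (dumbbell 0 0) ⊠ (mk (X 1 2 0) ⊠ mk (wires 1) ⨟ mk triangle ⊠ (mk (Z 2 1 0) ⨟ (mk triangle).transpose) ⨟ mk (Z 2 1 0))) ⨟ mk (Z 2 1 0)) = mk (dumbbell 0 0) ⊠ (mk (X 1 2 4) ⊠ mk (wires 1) ⨟ mk triangle ⊠ (mk (Z 2 1 0) ⨟ (mk triangle).transpose) ⨟ mk (Z 2 1 0)) :=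
  swappedCNOT_lhs_relayout.symm.trans tc_swappedCNOT_under_transistor

/-- **JPV'19 `swapped-CNOT-under-controlsep`, switch orientation**: green-copying the target and red-merging one copy into
the control negates the control: `(Z^{(1,2)} ⊗ 𝕀) ⨾ (𝕀 ⊗ (√2 ⊗ X^{(2,1)})) ⨾ sw = (𝕀 ⊗ X(π)) ⨾ sw`  (`t ∧ ¬(t ⊕ x) = t ∧ x`).
[cite: JeandelPerdrixVilmart2019, Appendix B, Lemma `swapped-CNOT-under-controlsep` and its proof (looped triangle, Appendix Lemma 29 of JPV'18)] -/
theorem zsplit_xmerge_seq_switch : mk (Z 1 2 0) ⊠ mk (wires 1) ⨟ mk (wires 1) ⊠ (mk (dumbbell 0 0) ⊠ mk (X 2 1 0)) ⨟ mk switch = mk (wires 1) ⊠ mk (X 1 1 4) ⨟ mk switch :=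
  flat_swappedCNOT_lhs.symm.trans ((congrArg (fun A : ZXClass 2 1 => mk (wires 2) ⊠ mk cup ⨟ (mk (wires 1) ⊠ A) ⊠ mk (wires 1) ⨟ mk cap ⊠ mk (wires 1)) swappedCNOT_core).trans flat_swappedCNOT_rhs)


end ZXClass

end Literature.Computability.QuantumComplexity
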